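import Literature.Geometry.Lorentzian.KerrAxisymmetricLowFrequencyEstimate
import Literature.Geometry.Lorentzian.KerrLowFrequencyPotentialSmallA
import HarnessLib

/-!
# The low-frequency, small-`a` subrange of `𝓖_♭`: Proposition 8.7.1 of
# Dafermos–Rodnianski–Shlapentokh-Rothman, with explicit multipliers and `a`-uniform constants

(family `gr`, infrastructure for statement **gr.S24**; namespace `Literature.Geometry.Lorentzian.Kerr`)

Dafermos–Rodnianski–Shlapentokh-Rothman (*Decay for solutions of the wave equation on Kerr exterior
spacetimes III*, arXiv:1402.7034 = Ann. of Math. 183 (2016)), Proposition 8.7.1: for `a₀ < M`, all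
`ω_high, ε_width > 0`, all `ω_low > 0`, `ã₀ > 0` sufficiently small depending on `ω_high` and
`ε_width`, all `R_∞` large, all `E ≥ 2`, `0 ≤ a ≤ a₀`, and all `(ω, m, Λ) ∈ 𝓖_♭` with `|ω| ≤ ω_low`
and `0 ≤ a < ã₀` (there also `m ≠ 0`, only to make the subranges disjoint, cf. Remark 8.7.1) there
are functions `y, ŷ, χ₁, χ₂, h` with `|y| + |ŷ| + |h| + |χ₂| ≤ B`, `χ₂ = 1, χ₁ = 0, y = 1, ŷ = 0,
h = 0` for `r* ≥ R*_∞`, such that for all solutions of `u'' + (ω² − V)u = H` with the outgoing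
boundary conditions (eq:b±),
`b ∫_{R₋*}^{R₊*} (|u'|² + |u|²) ≤ ∫ (2(y + ŷ)Re(u'H̄) + hRe(uH̄) + Eωχ₁Im(Hū) + χ₂(ω − ω₊m)Im(Hū))`
(current `Ϙ^h + ϟ^y + ϟ^ŷ − E χ₂Q^T − χ₁Q^K`).

This file proves it with **explicit multipliers** `Kerr.lowFreqMultipliers M a ω m Λ R P`
(`KerrCombinedCurrent.Multipliers` with `f = 0`, the `h, y` of `KerrAxisymmetricLowFrequencyEstimate`
built on `W(t) = V(R(t + x₀))` and **`W̃(t) = V(R(x₁ − t)) − V(r₊)`** (`Ṽ ≐ V − V|_{r=r₊}` of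
(haty2)), and the cut-offs **`χ₂(r*) = ψ((r* − x_c)/ℓ)`, `χ₁ = 1 − χ₂`** (`ψ = softStep`)
switching from `Q^K` at the horizon to `Q^T` at infinity across the middle region, where the bulk
error `−E(χ₂'ω + χ₁'(ω − ω₊m))Im(u'ū) = −Eχ₂'ω₊m Im(u'ū)` is absorbed for `a√Λ₁` small), and with
**`a`-uniform constants**: the smallness conditions on `a` ("`a < ã₀`") are the explicit
inequalities `Kerr.LowFreq.SmallA` in terms of quantities depending only on `M`, `Λ₁`, `δ₀`,
`R_b`, `E` and the bounds `D₁, D₂` for `φ', φ''` (`r₊(a) ∈ [93M/50, 2M]`, `κ_H(a) ≥ 1/(14M³)`, …,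
from `KerrLowFrequencyPotentialSmallA`), and so are `ω₀` ("`ω_low`") and the coercivity constant
`b`. The potential input is `KerrLowFrequencyPotentialSmallA` (`V = V_axi + P`); `m = 0` is
allowed.

* `Kerr.farPotentialM`, `Kerr.nearPotentialTilde` (+ `…Deriv`), `Kerr.far_data_smallA`,
  `Kerr.farPotentialM_le`, `Kerr.near_data_smallA`.
* `Kerr.LowFreq.*` — the `a`-free constants (`sN`, `T'`, `ε'`, `p'`, `Te'`, `ω₂`, `Rb'`, `T`,
  `ε`, `p`, `Te`, `ω₁`, `v`, `ω₀`, `BN`, `U₁max`, `BF`, `b`, `ℓ`) and `Kerr.LowFreq.SmallA`.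
* `Kerr.LowFreqCutParams`, `Kerr.lowFreqMultipliers`, `Kerr.hasDerivs_lowFreqMultipliers`, zone
  values, `Kerr.combinedBulk_lowFreq`, `Kerr.combinedBulk_lowFreq_nonneg`, end limits,
  integrability of the source, **`Kerr.lowFreq_estimate_of_params`**, **`Kerr.lowFreq_estimate`**
  (Prop. 8.7.1), `Kerr.lowFreq_estimate_of_isFreqFlat`.

Sign conventions for the source are those of `KerrCombinedCurrent.combinedSource`:
`−h Re(uH̄) − 2y Re(u'H̄) + E(χ₂ω + χ₁(ω − ω₊m)) Im(Hū)` (in particular the `Q^K` cut-off carries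
the factor `E` too, as in `KerrTrappingEstimate`; the printed display has `χ₁`, `χ₂` interchanged
relative to its proof and no `E` on the `Q^K` term — immaterial rescalings).

No named facts (D-0026); everything is proved.

## References

* M. Dafermos, I. Rodnianski, Y. Shlapentokh-Rothman, arXiv:1402.7034 = Ann. of Math. 183 (2016),
  §8.7.1, Prop. 8.7.1 and its proof ((ccchoices)–(axisym3), the cut-offs `χ₁`, `χ₂` and the
  absorption of the boundary terms), Remark 8.7.1, §8.8 (order of the choices `E`, then `ã₀`,
  `ω_low`) (key `DafermosRodnianskiShlapentokhrothman2014`).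
-/

noncomputable section

open Set Filter Topology MeasureTheory
open scoped InnerProductSpace ComplexConjugate

namespace Literature.Geometry.Lorentzian

namespace Kerr

/-! ### The one-sided potentials for general `m`: `W(t) = V(R(t + x₀))`, `W̃(t) = V(R(x₁ − t)) − V(r₊)` -/

/-- The far-side potential `W(t) = V(R(t + x₀))`. [cite: DafermosRodnianskiShlapentokhrothman2014, Prop. 8.7.1 (proof)] -/
def farPotentialM (M a ω : ℝ) (m : ℤ) (Λ : ℝ) (R : ℝ → ℝ) (x₀ t : ℝ) : ℝ :=
  sepPotential M a ω m Λ (R (t + x₀))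

/-- `dW/dt`. [folklore] -/
def farPotentialMDeriv (M a ω : ℝ) (m : ℤ) (Λ : ℝ) (R : ℝ → ℝ) (x₀ t : ℝ) : ℝ :=
  deriv (sepPotential M a ω m Λ) (R (t + x₀)) *
    (delta M a (R (t + x₀)) / (R (t + x₀) ^ 2 + a ^ 2))

/-- **The near-side potential `W̃(t) = Ṽ(R(x₁ − t))`, `Ṽ = V − V|_{r=r₊}`** (DRSR
arXiv:1402.7034, (haty2)), in the reflected variable `t = x₁ − r*`. [cite: DafermosRodnianskiShlapentokhrothman2014, Prop. 8.7.1 (proof)] -/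
def nearPotentialTilde (M a ω : ℝ) (m : ℤ) (Λ : ℝ) (R : ℝ → ℝ) (x₁ t : ℝ) : ℝ :=
  sepPotential M a ω m Λ (R (x₁ - t)) - sepPotential M a ω m Λ (rPlus M a)

/-- `dW̃/dt`. [folklore] -/
def nearPotentialTildeDeriv (M a ω : ℝ) (m : ℤ) (Λ : ℝ) (R : ℝ → ℝ) (x₁ t : ℝ) : ℝ :=
  -(deriv (sepPotential M a ω m Λ) (R (x₁ - t)) *
    (delta M a (R (x₁ - t)) / (R (x₁ - t) ^ 2 + a ^ 2)))

section Data

variable {M a ω ωl Λ Λ₁ : ℝ} {m : ℤ} {R : ℝ → ℝ}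

/-- `W'` is the derivative of `W`. [folklore] -/
theorem hasDerivAt_farPotentialM (hR : IsTortoiseRadius M a R) (hMa : IsSubextremal M a) (x₀ t : ℝ) :
    HasDerivAt (farPotentialM M a ω m Λ R x₀) (farPotentialMDeriv M a ω m Λ R x₀ t) t := by
  have h := (hasDerivAt_sepPotential_comp (ω := ω) (m := m) (Λ := Λ) hR hMa (t + x₀)).comp t
    ((hasDerivAt_id t).add_const x₀)
  unfold farPotentialM farPotentialMDeriv
  simpa [Function.comp_def] using h

/-- `W̃'` is the derivative of `W̃`. [folklore] -/
theorem hasDerivAt_nearPotentialTilde (hR : IsTortoiseRadius M a R) (hMa : IsSubextremal M a)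
    (x₁ t : ℝ) :
    HasDerivAt (nearPotentialTilde M a ω m Λ R x₁) (nearPotentialTildeDeriv M a ω m Λ R x₁ t) t := by
  have h := ((hasDerivAt_sepPotential_comp (ω := ω) (m := m) (Λ := Λ) hR hMa (x₁ - t)).comp t
    ((hasDerivAt_const t x₁).sub (hasDerivAt_id t))).sub_const (sepPotential M a ω m Λ (rPlus M a))
  unfold nearPotentialTilde nearPotentialTildeDeriv
  refine (h.congr_of_eventuallyEq (Eventually.of_forall fun s ↦ rfl)).congr_deriv ?_
  simp

/-- **The far-side data for small `a`**: `R(x_b) = R_b' ≥ 20M`, `x₀ = x_b − R_b'`, `T = R_b' + 1`,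
`0 ≤ a`, `2a ≤ M`, `|ω| ≤ ω_l`, `20aω_l ≤ 1`, admissible triple. Then for `t ≥ T − 1`:
`R_b' ≤ R(t + x₀) ≤ t`, `W(t) > 0`, `(3/2)W(t) ≤ −tW'(t)`, `W(t) ≥ M/(2t³)`.
[cite: DafermosRodnianskiShlapentokhrothman2014, Prop. 8.7.1 (proof)] -/
theorem far_data_smallA (hM : 0 < M) (ha0 : 0 ≤ a) (ha2 : 2 * a ≤ M) (hR : IsTortoiseRadius M a R)
    {Rb' xb x₀ T : ℝ} (hRb : 20 * M ≤ Rb') (hxb : R xb = Rb') (hx₀ : x₀ = xb - Rb')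
    (hT : T = Rb' + 1) (hadm : IsAdmissibleTriple a ω m Λ) (hω : |ω| ≤ ωl)
    (hsmall : 20 * (a * ωl) ≤ 1) {t : ℝ} (ht : T - 1 ≤ t) :
    (Rb' ≤ R (t + x₀) ∧ R (t + x₀) ≤ t) ∧ 0 < farPotentialM M a ω m Λ R x₀ t ∧
      (1 + 1 / 2) * farPotentialM M a ω m Λ R x₀ t ≤ -(t * farPotentialMDeriv M a ω m Λ R x₀ t) ∧
      M / (2 * t ^ 3) ≤ farPotentialM M a ω m Λ R x₀ t := by
  have hMa : IsSubextremal M a := by unfold IsSubextremal; rw [abs_of_nonneg ha0]; linarith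
  have haM : |a| ≤ M := le_of_lt hMa
  have hrp2 : rPlus M a ≤ 2 * M := rPlus_le_two_mul_smallA hM.le a
  have hxb' : xb ≤ t + x₀ := by rw [hx₀]; linarith
  have hmono := (hR.strictMono hMa).monotone
  have hR1 : Rb' ≤ R (t + x₀) := by rw [← hxb]; exact hmono hxb'
  have hR2 : R (t + x₀) ≤ t := by
    have h := hR.sub_le hMa hxb'
    rw [hxb] at h
    have e : t + x₀ - xb = t - Rb' := by rw [hx₀]; ring
    linarith
  set r := R (t + x₀) with hr
  have hr20 : 20 * M ≤ r := hRb.trans hR1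
  have hrp : rPlus M a < r := by linarith
  have hr0 : 0 < r := by linarith
  have ht0 : 0 < t := by linarith
  have hlow : M / (2 * r ^ 3) ≤ sepPotential M a ω m Λ r :=
    sepPotential_ge_smallA_far hM ha0 ha2 hadm hω hsmall hr20
  have hV : 0 < farPotentialM M a ω m Λ R x₀ t := by
    unfold farPotentialM; rw [← hr]; exact lt_of_lt_of_le (by positivity) hlow
  have hq0 : 0 < delta M a r / (r ^ 2 + a ^ 2) := div_pos (delta_pos haM hrp) (by positivity)
  have hratio := sepPotential_far_ratio_smallA hM ha0 ha2 hadm hω hsmall hr20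
  have hVpos : 0 < sepPotential M a ω m Λ r := lt_of_lt_of_le (by positivity) hlow
  have hVr : -deriv (sepPotential M a ω m Λ) r ≥ 0 := by
    by_contra hcon
    have hcon' : -deriv (sepPotential M a ω m Λ) r < 0 := lt_of_not_ge hcon
    have : r * (delta M a r / (r ^ 2 + a ^ 2)) * -deriv (sepPotential M a ω m Λ) r < 0 :=
      mul_neg_of_pos_of_neg (mul_pos hr0 hq0) hcon'
    linarith
  refine ⟨⟨hR1, hR2⟩, hV, ?_, ?_⟩
  · unfold farPotentialM farPotentialMDeriv
    rw [← hr]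
    have h1 : r * (delta M a r / (r ^ 2 + a ^ 2)) * -deriv (sepPotential M a ω m Λ) r ≤
        t * (delta M a r / (r ^ 2 + a ^ 2)) * -deriv (sepPotential M a ω m Λ) r := by
      have : 0 ≤ (delta M a r / (r ^ 2 + a ^ 2)) * -deriv (sepPotential M a ω m Λ) r :=
        mul_nonneg hq0.le hVr
      nlinarith
    nlinarith
  · unfold farPotentialM
    rw [← hr]
    calc M / (2 * t ^ 3) ≤ M / (2 * r ^ 3) := by
          apply div_le_div_of_nonneg_left hM.le (by positivity); gcongr
      _ ≤ sepPotential M a ω m Λ r := hlow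

/-- `W(t) ≤ 12(Λ + 1)/t²` for `t ≥ T − 1` (from `|V| ≤ 3Λ/r² + 3M/r³`, `R(t + x₀) ≥ t/2`). [folklore] -/
theorem farPotentialM_le (hM : 0 < M) (ha0 : 0 ≤ a) (ha2 : 2 * a ≤ M) (hR : IsTortoiseRadius M a R)
    {Rb' xb x₀ T : ℝ} (hRb : 20 * M ≤ Rb') (hxb : R xb = Rb') (hx₀ : x₀ = xb - Rb')
    (hT : T = Rb' + 1) (hadm : IsAdmissibleTriple a ω m Λ) {t : ℝ} (ht : T - 1 ≤ t) :
    farPotentialM M a ω m Λ R x₀ t ≤ 12 * (Λ + 1) / t ^ 2 := by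
  have hMa : IsSubextremal M a := by unfold IsSubextremal; rw [abs_of_nonneg ha0]; linarith
  have haM : |a| ≤ M := le_of_lt hMa
  have hΛ := hadm.nonneg
  have hrp2 : rPlus M a ≤ 2 * M := rPlus_le_two_mul_smallA hM.le a
  have hxb' : xb ≤ t + x₀ := by rw [hx₀]; linarith
  have hmono := (hR.strictMono hMa).monotone
  have hR1 : Rb' ≤ R (t + x₀) := by rw [← hxb]; exact hmono hxb'
  set r := R (t + x₀) with hr
  have hrp : rPlus M a ≤ r := by linarith
  have hr0 : 0 < r := by linarith
  have ht0 : 0 < t := by linarith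
  have hgrow := hR.mul_sub_le hMa hxb'
  rw [hxb] at hgrow
  have hq' : 1 / 2 ≤ delta M a Rb' / (Rb' ^ 2 + a ^ 2) := half_le_delta_div hM haM hRb
  have hrt : t / 2 ≤ r := by
    have e : t + x₀ - xb = t - Rb' := by rw [hx₀]; ring
    rw [e] at hgrow
    have h1 : 1 / 2 * (t - Rb') ≤ R (t + x₀) - Rb' :=
      le_trans (mul_le_mul_of_nonneg_right hq' (by linarith)) hgrow
    rw [hr]
    linarith
  have hV := abs_sepPotential_le (ω := ω) (m := m) hM haM hadm hrp
  have hV' := le_abs_self (sepPotential M a ω m Λ r)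
  unfold farPotentialM
  rw [← hr]
  have h1 : 3 * Λ / r ^ 2 ≤ 3 * Λ / (t / 2) ^ 2 := by
    apply div_le_div_of_nonneg_left (by positivity) (by positivity); gcongr
  have h2 : 3 * M / r ^ 3 ≤ 3 / (t / 2) ^ 2 := by
    rw [div_le_div_iff₀ (by positivity) (by positivity)]
    have hMr : M ≤ r := (M_le_rPlus M a).trans hrp
    have : (t / 2) ^ 2 ≤ r ^ 2 := by gcongr
    nlinarith [mul_le_mul this hMr hM.le (by positivity)]
  have e : 3 * Λ / (t / 2) ^ 2 + 3 / (t / 2) ^ 2 = 12 * (Λ + 1) / t ^ 2 := by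
    field_simp; ring
  linarith

/-- **The near-side data for small `a`** (the hypotheses of `lowFreq_coeff_nonneg` at the horizon
end for `W̃ = Ṽ ∘ R`): `0 < s_N ≤ r₊`, `s_N·L(Λ₁) ≤ κ_H/2`, `R(x_N) = r₊ + s_N`, `T' ≥ T₀' + 2`,
`x₁ = x_N + T' − 1`, `Λ ≤ Λ₁`, `0 ≤ a`, `2a ≤ M`, `|ω| ≤ ω_l`, `20aω_l ≤ 1`. Then for
`t ≥ T' − 1`: `r₊ < R ≤ r₊ + s_N`, `W̃ > 0`, `(3/2)W̃ ≤ −tW̃'`,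
`(κ_H/2)(R − r₊) ≤ W̃ ≤ κ₂(R − r₊)`, and the exponential bounds on `R − r₊`.
[cite: DafermosRodnianskiShlapentokhrothman2014, Prop. 8.7.1 (proof)] -/
theorem near_data_smallA (hM : 0 < M) (ha0 : 0 ≤ a) (ha2 : 2 * a ≤ M) (hR : IsTortoiseRadius M a R)
    {sN xN x₁ T' : ℝ} (hadm : IsAdmissibleTriple a ω m Λ) (hΛ : Λ ≤ Λ₁) (hω : |ω| ≤ ωl)
    (hsmall : 20 * (a * ωl) ≤ 1) (hsN : 0 < sN)
    (hsNL : sN * horizonCurv M a Λ₁ ≤ horizonSlope M a / 2) (hsNr : sN ≤ rPlus M a)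
    (hxN : R xN = rPlus M a + sN) (hT' : nearThreshold M a Λ₁ + 2 ≤ T')
    (hx₁ : x₁ = xN + T' - 1) {t : ℝ} (ht : T' - 1 ≤ t) :
    (rPlus M a < R (x₁ - t) ∧ R (x₁ - t) ≤ rPlus M a + sN) ∧
      0 < nearPotentialTilde M a ω m Λ R x₁ t ∧
      (1 + 1 / 2) * nearPotentialTilde M a ω m Λ R x₁ t ≤
        -(t * nearPotentialTildeDeriv M a ω m Λ R x₁ t) ∧
      (horizonSlope M a / 2 * (R (x₁ - t) - rPlus M a) ≤ nearPotentialTilde M a ω m Λ R x₁ t ∧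
        nearPotentialTilde M a ω m Λ R x₁ t ≤ horizonDerivBound M a Λ₁ * (R (x₁ - t) - rPlus M a)) ∧
      (sN * Real.exp (-(t - (T' - 1)) / M) ≤ R (x₁ - t) - rPlus M a ∧
        R (x₁ - t) - rPlus M a ≤
          sN * Real.exp (-(√(M ^ 2 - a ^ 2) / (4 * rPlus M a ^ 2)) * (t - (T' - 1)))) := by
  have hMa : IsSubextremal M a := by unfold IsSubextremal; rw [abs_of_nonneg ha0]; linarith
  have haM : |a| ≤ M := le_of_lt hMa
  have hrpM : M ≤ rPlus M a := M_le_rPlus M a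
  have hrp0 : 0 < rPlus M a := hM.trans_le hrpM
  have hΛ0 := hadm.nonneg
  have hΛ₁ : 0 ≤ Λ₁ := hΛ0.trans hΛ
  have hκ := horizonSlope_pos hMa
  obtain ⟨hκ₂, hT₀⟩ := horizonDerivBound_nonneg hMa hΛ₁
  have hsq : 0 < M ^ 2 - a ^ 2 := by
    have := hMa; unfold IsSubextremal at this
    nlinarith [abs_nonneg a, sq_abs a]
  have hroot : 0 < √(M ^ 2 - a ^ 2) := Real.sqrt_pos.2 hsq
  set x := x₁ - t with hx
  have hxxN : x ≤ xN := by rw [hx, hx₁]; linarith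
  have hmono := (hR.strictMono hMa).monotone
  have hRx : R x ≤ rPlus M a + sN := by rw [← hxN]; exact hmono hxxN
  have hRx' : rPlus M a < R x := hR.rPlus_lt x
  set r := R x with hr
  set s := r - rPlus M a with hs
  have hs0 : 0 < s := by rw [hs]; linarith
  have hssN : s ≤ sN := by rw [hs]; linarith
  have hr2 : r ≤ 2 * rPlus M a := by linarith
  have hr0 : 0 < r := by linarith
  have hVb := sepPotentialTilde_near_bounds_smallA hM ha0 ha2 hadm hω hsmall hΛ hsNL hRx'.le hRx
  have hVd := deriv_sepPotential_near_smallA hM ha0 ha2 hadm hω hsmall hΛ hsNL hRx'.le hRx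
  have hκ₂' : 24 * Λ / rPlus M a ^ 3 + 184 * M / rPlus M a ^ 4 ≤ horizonDerivBound M a Λ₁ := by
    unfold horizonDerivBound; gcongr
  have hVup : nearPotentialTilde M a ω m Λ R x₁ t ≤ horizonDerivBound M a Λ₁ * s := by
    unfold nearPotentialTilde; rw [← hx, ← hr]
    exact hVb.2.trans (mul_le_mul_of_nonneg_right hκ₂' hs0.le)
  have hVlo : horizonSlope M a / 2 * s ≤ nearPotentialTilde M a ω m Λ R x₁ t := by
    unfold nearPotentialTilde; rw [← hx, ← hr]; exact hVb.1
  have hVpos : 0 < nearPotentialTilde M a ω m Λ R x₁ t := lt_of_lt_of_le (by positivity) hVlo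
  have hs0' : 0 ≤ s * √(M ^ 2 - a ^ 2) := by positivity
  have hr4 : r ^ 2 ≤ 4 * rPlus M a ^ 2 := by
    calc r ^ 2 ≤ (2 * rPlus M a) ^ 2 := pow_le_pow_left₀ hr0.le hr2 2
      _ = 4 * rPlus M a ^ 2 := by ring
  have hq : s * √(M ^ 2 - a ^ 2) / (4 * rPlus M a ^ 2) ≤ delta M a r / (r ^ 2 + a ^ 2) := by
    refine le_trans ?_ (delta_div_ge hMa hRx'.le)
    rw [← hs, div_le_div_iff₀ (by positivity) (by positivity)]
    exact mul_le_mul_of_nonneg_left hr4 hs0'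
  refine ⟨⟨hRx', hRx⟩, hVpos, ?_, ⟨hVlo, hVup⟩, ?_⟩
  · have ht0 : nearThreshold M a Λ₁ ≤ t := by linarith
    unfold nearPotentialTildeDeriv
    rw [← hx, ← hr, neg_mul_eq_mul_neg, neg_neg]
    have hVr : horizonSlope M a / 2 ≤ deriv (sepPotential M a ω m Λ) r := hVd.1
    have hq0 : 0 ≤ s * √(M ^ 2 - a ^ 2) / (4 * rPlus M a ^ 2) := by positivity
    have h1 : t * (horizonSlope M a / 2 * (s * √(M ^ 2 - a ^ 2) / (4 * rPlus M a ^ 2))) ≤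
        t * (deriv (sepPotential M a ω m Λ) r * (delta M a r / (r ^ 2 + a ^ 2))) := by
      apply mul_le_mul_of_nonneg_left _ (hT₀.trans ht0)
      exact mul_le_mul hVr hq hq0 (by linarith)
    have h2 : (1 + 1 / 2) * (horizonDerivBound M a Λ₁ * s) ≤
        t * (horizonSlope M a / 2 * (s * √(M ^ 2 - a ^ 2) / (4 * rPlus M a ^ 2))) := by
      have h := ht0
      unfold nearThreshold at h
      rw [div_le_iff₀ (by positivity)] at h
      have h' := mul_le_mul_of_nonneg_right h hs0.le
      have e1 : (1 + 1 / 2) * (horizonDerivBound M a Λ₁ * s) =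
          12 * horizonDerivBound M a Λ₁ * rPlus M a ^ 2 * s / (8 * rPlus M a ^ 2) := by
        field_simp
        ring
      have e2 : t * (horizonSlope M a / 2 * (s * √(M ^ 2 - a ^ 2) / (4 * rPlus M a ^ 2))) =
          t * (√(M ^ 2 - a ^ 2) * horizonSlope M a) * s / (8 * rPlus M a ^ 2) := by
        ring
      rw [e1, e2]
      exact div_le_div_of_nonneg_right h' (by positivity)
    have h3 : (1 + 1 / 2) * nearPotentialTilde M a ω m Λ R x₁ t ≤
        (1 + 1 / 2) * (horizonDerivBound M a Λ₁ * s) :=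
      mul_le_mul_of_nonneg_left hVup (by norm_num)
    exact h3.trans (h2.trans h1)
  · constructor
    · have h := hR.sub_rPlus_ge hMa hxxN
      rw [hxN, add_sub_cancel_left] at h
      have e : xN - x = t - (T' - 1) := by rw [hx, hx₁]; ring
      rw [e] at h
      exact h
    · have h := hR.sub_rPlus_le hMa hxxN (by rw [hxN]; linarith)
      rw [hxN, add_sub_cancel_left] at h
      have e : xN - x = t - (T' - 1) := by rw [hx, hx₁]; ring
      rw [e] at h
      exact h

end Data

/-! ### The `a`-uniform constants -/

namespace LowFreq

/-- `κ_u = 1/(14M³) ≤ κ_H(a)` for `2a ≤ M`. [folklore] -/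
def κu (M : ℝ) : ℝ := 1 / (14 * M ^ 3)

/-- `L_u = (216Λ₁ + 2896)/M⁴ ≥ L(a, Λ₁)`. [folklore] -/
def Lu (M Λ₁ : ℝ) : ℝ := 216 * Λ₁ / M ^ 4 + 2896 / M ^ 4

/-- `κ₂ᵘ = (24Λ₁ + 184)/M³ ≥ κ₂(a, Λ₁)`. [folklore] -/
def κ₂u (M Λ₁ : ℝ) : ℝ := 24 * Λ₁ / M ^ 3 + 184 / M ^ 3

/-- The near margin `s_N = min(δ₀, κ_u/(2(L_u + 1)), M)`. [folklore] -/
def sN (M Λ₁ δ₀ : ℝ) : ℝ := min δ₀ (min (κu M / (2 * (Lu M Λ₁ + 1))) M)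

/-- The near zone start `T' = 12κ₂ᵘ(2M)²/((43M/50)κ_u) + 2 ≥ T₀'(a) + 2`. [folklore] -/
def T' (M Λ₁ : ℝ) : ℝ := 12 * κ₂u M Λ₁ * (2 * M) ^ 2 / (43 / 50 * M * κu M) + 2

/-- The near gain `ε' = T'κ_u s_N e^{−1/M}/10`. [folklore] -/
def ε' (M Λ₁ δ₀ : ℝ) : ℝ := T' M Λ₁ * κu M * sN M Λ₁ δ₀ * Real.exp (-(1 / M)) / 10

/-- The near log-zone rate `p' = min(1, 2ε'/(D₁ + D₂ + 1))`. [folklore] -/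
def p' (M Λ₁ δ₀ D₁ D₂ : ℝ) : ℝ := min 1 (2 * ε' M Λ₁ δ₀ / (D₁ + D₂ + 1))

/-- The near log-zone end `Te' = 2T'e^{1/p'}`. [folklore] -/
def Te' (M Λ₁ δ₀ D₁ D₂ : ℝ) : ℝ := 2 * T' M Λ₁ * Real.exp (1 / p' M Λ₁ δ₀ D₁ D₂)

/-- The near frequency threshold `ω₂ = (κ_u/2) s_N e^{−(Te' − T' + 1)/M} ≤ W̃(Te')`. [folklore] -/
def ω₂ (M Λ₁ δ₀ D₁ D₂ : ℝ) : ℝ :=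
  κu M / 2 * (sN M Λ₁ δ₀ * Real.exp (-(Te' M Λ₁ δ₀ D₁ D₂ - (T' M Λ₁ - 1)) / M))

/-- The far radius `R_b' = max(R_b, 20M)`. [folklore] -/
def Rb' (M Rb : ℝ) : ℝ := max Rb (20 * M)

/-- The far zone start `T = R_b' + 1`. [folklore] -/
def T (M Rb : ℝ) : ℝ := Rb' M Rb + 1

/-- The far gain `ε = M/(10T²)`. [folklore] -/
def ε (M Rb : ℝ) : ℝ := M / (10 * T M Rb ^ 2)

/-- The far log-zone rate `p = min(1, 2ε/(D₁ + D₂ + 1))`. [folklore] -/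
def p (M Rb D₁ D₂ : ℝ) : ℝ := min 1 (2 * ε M Rb / (D₁ + D₂ + 1))

/-- The far log-zone end `Te = 2Te^{1/p}`. [folklore] -/
def Te (M Rb D₁ D₂ : ℝ) : ℝ := 2 * T M Rb * Real.exp (1 / p M Rb D₁ D₂)

/-- The far frequency threshold `ω₁ = M/(2Te³) ≤ W(Te)`. [folklore] -/
def ω₁ (M Rb D₁ D₂ : ℝ) : ℝ := M / (2 * Te M Rb D₁ D₂ ^ 3)

/-- The middle lower bound `v = min(s_N·(43M/25)·(2M·(93M/50)·3M²)/(17M²)⁴, M/(2R_b'³)) ≤ V₁`.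
[folklore] -/
def v (M Λ₁ δ₀ Rb : ℝ) : ℝ :=
  min (sN M Λ₁ δ₀ * (43 / 25 * M) * (2 * M * (93 / 50 * M) * (3 * M ^ 2)) / (17 * M ^ 2) ^ 4)
    (M / (2 * Rb' M Rb ^ 3))

/-- **`ω₀² = min(v/2, ω₁, ω₂/4)`** — the square of "`ω_low`". [folklore] -/
def ω₀sq (M Λ₁ δ₀ Rb D₁ D₂ : ℝ) : ℝ :=
  min (v M Λ₁ δ₀ Rb / 2) (min (ω₁ M Rb D₁ D₂) (ω₂ M Λ₁ δ₀ D₁ D₂ / 4))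

/-- **`ω₀ = √ω₀²`** ("`ω_low`"). [folklore] -/
def ω₀ (M Λ₁ δ₀ Rb D₁ D₂ : ℝ) : ℝ := √(ω₀sq M Λ₁ δ₀ Rb D₁ D₂)

/-- The near saturation level bound `B_N = ½ + ε'(1/(Te'ω₂) + ½) ≥ Y_N(∞)`. [folklore] -/
def BN (M Λ₁ δ₀ D₁ D₂ : ℝ) : ℝ :=
  1 / 2 + ε' M Λ₁ δ₀ * (1 / (Te' M Λ₁ δ₀ D₁ D₂ * ω₂ M Λ₁ δ₀ D₁ D₂) + 1 / 2)

/-- The far saturation level bound `U₁ᵐᵃˣ = max(1/(Teω₁), B_N/ε)`. [folklore] -/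
def U₁max (M Λ₁ δ₀ Rb D₁ D₂ : ℝ) : ℝ :=
  max (1 / (Te M Rb D₁ D₂ * ω₁ M Rb D₁ D₂)) (BN M Λ₁ δ₀ D₁ D₂ / ε M Rb)

/-- The far top bound `B_F = ½ + ε(U₁ᵐᵃˣ + ½) ≥ Y_F(∞)`. [folklore] -/
def BF (M Λ₁ δ₀ Rb D₁ D₂ : ℝ) : ℝ := 1 / 2 + ε M Rb * (U₁max M Λ₁ δ₀ Rb D₁ D₂ + 1 / 2)

/-- **The coercivity constant `b = min(1, v/2)/(2B_F)`.** [folklore] -/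
def b (M Λ₁ δ₀ Rb D₁ D₂ : ℝ) : ℝ := min 1 (v M Λ₁ δ₀ Rb / 2) / (2 * BF M Λ₁ δ₀ Rb D₁ D₂)

/-- The lower bound `ℓ_u = R_b' − 3M` for the `r*`-length of the middle region (the support of
`χ₂'`). [folklore] -/
def ℓu (M Rb : ℝ) : ℝ := Rb' M Rb - 3 * M

/-- **The smallness conditions on `a`** ("`0 ≤ a < ã₀`, `ã₀` sufficiently small depending on
`ω_high`, `ε_width`" — and, through the cut-off error, on `E`, which in §8.8 is fixed before `ã₀`),
all with `a`-free right-hand sides: `2a ≤ M`; `20aω₀ ≤ 1` (far ratio and horizon slope);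
`2a² ≤ Ms_N`, `8Maω₀ ≤ s_N` (middle); `a²Λ₁ ≤ M⁴ω₂` (`(ω − ω₊m)² ≤ W̃(Te')`);
`E·a·√Λ₁·B_F ≤ M²ℓ_u·min(1, v/2)` (absorption of `−Eχ₂'ω₊m Im(u'ū)`).
[cite: DafermosRodnianskiShlapentokhrothman2014, Prop. 8.7.1] -/
structure SmallA (M a Λ₁ δ₀ Rb E D₁ D₂ : ℝ) : Prop where
  nonneg : 0 ≤ a
  half : 2 * a ≤ M
  farω : 20 * (a * ω₀ M Λ₁ δ₀ Rb D₁ D₂) ≤ 1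
  mid₁ : 2 * a ^ 2 ≤ M * sN M Λ₁ δ₀
  mid₂ : 8 * M * a * ω₀ M Λ₁ δ₀ Rb D₁ D₂ ≤ sN M Λ₁ δ₀
  nearϖ : a ^ 2 * Λ₁ ≤ M ^ 4 * ω₂ M Λ₁ δ₀ D₁ D₂
  cut : E * a * √Λ₁ * BF M Λ₁ δ₀ Rb D₁ D₂ ≤ M ^ 2 * ℓu M Rb * min 1 (v M Λ₁ δ₀ Rb / 2)

end LowFreq

/-! ### The multipliers with cut-offs -/

namespace LowFreqParams

/-- The start `x_N = x₁ − (T' − 1)` of the middle region. [folklore] -/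
def xN (P : LowFreqParams) : ℝ := P.x₁ - (P.T' - 1)

/-- The end `x_b = x₀ + (T − 1)` of the middle region. [folklore] -/
def xb (P : LowFreqParams) : ℝ := P.x₀ + (P.T - 1)

/-- The `r*`-length `ℓ = x_b − x_N` of the middle region (the support of `χ₂'`). [folklore] -/
def ℓ (P : LowFreqParams) : ℝ := P.xb - P.xN

end LowFreqParams

/-- **The multipliers of Proposition 8.7.1** (DRSR arXiv:1402.7034) as a `Multipliers` record:
`f = 0`; `h(r*) = σ(h_F(r* − x₀) + h_N(x₁ − r*) − 1)`, `y(r*) = σ(Y_F(r* − x₀) − Y_N(x₁ − r*))` with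
the one-sided profiles of `KerrLowFrequencyProfiles` for `W = farPotentialM` and
`W̃ = nearPotentialTilde`; `χ₂(r*) = ψ((r* − x_N)/ℓ)`, `χ₁ = 1 − χ₂` (`ψ = softStep`), so that
`χ₂ = 0, χ₁ = 1` towards the horizon and `χ₂ = 1, χ₁ = 0` towards infinity ("Let `χ₂` be a function
which is identically `1` for `r* ≥ R₊*` and identically `0` for `r* ≤ R₋*`", "Let `χ₁` be a function
which is identically `1` for `r* ∈ (−∞, R₁*)` and identically `0` for `r* ≥ R₂*`").
[cite: DafermosRodnianskiShlapentokhrothman2014, Prop. 8.7.1 (proof)] -/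
def lowFreqMultipliers (M a ω : ℝ) (m : ℤ) (Λ : ℝ) (R : ℝ → ℝ) (P : LowFreqParams) : Multipliers where
  f := 0
  f' := 0
  f'' := 0
  f''' := 0
  h := fun x ↦ P.σ * (lowFreqCutoff P.p (2 * P.T) (x - P.x₀) +
    lowFreqCutoff P.p' (2 * P.T') (P.x₁ - x) - 1)
  h' := fun x ↦ P.σ * (lowFreqCutoff₁ P.p (2 * P.T) (x - P.x₀) -
    lowFreqCutoff₁ P.p' (2 * P.T') (P.x₁ - x))
  h'' := fun x ↦ P.σ * (lowFreqCutoff₂ P.p (2 * P.T) (x - P.x₀) +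
    lowFreqCutoff₂ P.p' (2 * P.T') (P.x₁ - x))
  y := fun x ↦ P.σ * (lowFreqWeight (farPotentialM M a ω m Λ R P.x₀) P.T P.ε P.u₀ P.U₁ (x - P.x₀) -
    lowFreqWeight (nearPotentialTilde M a ω m Λ R P.x₁) P.T' P.ε' P.u₀' P.U₁' (P.x₁ - x))
  y' := fun x ↦ P.σ *
    (lowFreqWeightDeriv (farPotentialM M a ω m Λ R P.x₀) (farPotentialMDeriv M a ω m Λ R P.x₀)
        P.T P.ε P.u₀ P.U₁ (x - P.x₀) +
      lowFreqWeightDeriv (nearPotentialTilde M a ω m Λ R P.x₁) (nearPotentialTildeDeriv M a ω m Λ R P.x₁)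
        P.T' P.ε' P.u₀' P.U₁' (P.x₁ - x))
  χ₁ := fun x ↦ 1 - softStep ((x - P.xN) / P.ℓ)
  χ₁' := fun x ↦ -(softStepDeriv ((x - P.xN) / P.ℓ) / P.ℓ)
  χ₂ := fun x ↦ softStep ((x - P.xN) / P.ℓ)
  χ₂' := fun x ↦ softStepDeriv ((x - P.xN) / P.ℓ) / P.ℓ

/-- **Validity of the parameters** for general `m`: as `LowFreqParams.Valid`, for the potentials
`farPotentialM`, `nearPotentialTilde`, with moreover `ℓ > 0` (the zones strictly separated).
[folklore] -/
structure LowFreqParams.ValidM (M a ω : ℝ) (m : ℤ) (Λ : ℝ) (R : ℝ → ℝ) (P : LowFreqParams) :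
    Prop where
  T_gt : 1 < P.T
  T'_gt : 1 < P.T'
  p_pos : 0 < P.p
  p'_pos : 0 < P.p'
  u₀_pos : 0 < P.u₀
  u₀'_pos : 0 < P.u₀'
  U₁_ge : P.u₀ ≤ P.U₁
  U₁'_ge : P.u₀' ≤ P.U₁'
  ℓ_pos : 0 < P.ℓ
  far_pos : ∀ t, P.T - 1 ≤ t → 0 < farPotentialM M a ω m Λ R P.x₀ t
  far_dec : ∀ t, P.T - 1 ≤ t →
    (1 + 1 / 2) * farPotentialM M a ω m Λ R P.x₀ t ≤ -(t * farPotentialMDeriv M a ω m Λ R P.x₀ t)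
  near_pos : ∀ t, P.T' - 1 ≤ t → 0 < nearPotentialTilde M a ω m Λ R P.x₁ t
  near_dec : ∀ t, P.T' - 1 ≤ t →
    (1 + 1 / 2) * nearPotentialTilde M a ω m Λ R P.x₁ t ≤
      -(t * nearPotentialTildeDeriv M a ω m Λ R P.x₁ t)

section Multipliers

variable {M a ω Λ : ℝ} {m : ℤ} {R : ℝ → ℝ} {P : LowFreqParams}

/-- `ℓ > 0` means `x_N < x_b`. [folklore] -/
theorem LowFreqParams.ValidM.xN_lt_xb (hP : P.ValidM M a ω m Λ R) : P.xN < P.xb := by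
  have := hP.ℓ_pos; unfold LowFreqParams.ℓ at this; linarith

/-- **The multipliers are differentiable** with the derivative fields of the record. [folklore] -/
theorem hasDerivs_lowFreqMultipliers (hMa : IsSubextremal M a) (hR : IsTortoiseRadius M a R)
    (hP : P.ValidM M a ω m Λ R) : (lowFreqMultipliers M a ω m Λ R P).HasDerivs where
  df := fun x ↦ hasDerivAt_const x _
  df' := fun x ↦ hasDerivAt_const x _
  df'' := fun x ↦ hasDerivAt_const x _
  dh := fun x ↦ by
    have hT : 0 < 2 * P.T := by linarith [hP.T_gt]
    have hT' : 0 < 2 * P.T' := by linarith [hP.T'_gt]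
    have h1 := (hasDerivAt_lowFreqCutoff hT hP.p_pos (x - P.x₀)).comp_sub_const x P.x₀
    have h2 := (hasDerivAt_lowFreqCutoff hT' hP.p'_pos (P.x₁ - x)).comp_const_sub P.x₁ x
    have h := ((h1.add h2).sub_const 1).const_mul P.σ
    refine h.congr_deriv ?_
    simp only [lowFreqMultipliers]
    ring
  dh' := fun x ↦ by
    have hT : 0 < 2 * P.T := by linarith [hP.T_gt]
    have hT' : 0 < 2 * P.T' := by linarith [hP.T'_gt]
    have h1 := (hasDerivAt_lowFreqCutoff₁ hT hP.p_pos (x - P.x₀)).comp_sub_const x P.x₀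
    have h2 := (hasDerivAt_lowFreqCutoff₁ hT' hP.p'_pos (P.x₁ - x)).comp_const_sub P.x₁ x
    have h := (h1.sub h2).const_mul P.σ
    refine h.congr_deriv ?_
    simp only [lowFreqMultipliers]
    ring
  dy := fun x ↦ by
    have h1 := (hasDerivAt_lowFreqWeight (W := farPotentialM M a ω m Λ R P.x₀)
      (W₁ := farPotentialMDeriv M a ω m Λ R P.x₀) (ε := P.ε) hP.T_gt (by norm_num : (0 : ℝ) ≤ 1 / 2)
      (fun t _ ↦ hasDerivAt_farPotentialM hR hMa P.x₀ t) hP.far_pos hP.far_dec hP.u₀_pos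
      (hP.u₀_pos.le.trans hP.U₁_ge) (x - P.x₀)).comp_sub_const x P.x₀
    have h2 := (hasDerivAt_lowFreqWeight (W := nearPotentialTilde M a ω m Λ R P.x₁)
      (W₁ := nearPotentialTildeDeriv M a ω m Λ R P.x₁) (ε := P.ε') hP.T'_gt
      (by norm_num : (0 : ℝ) ≤ 1 / 2)
      (fun t _ ↦ hasDerivAt_nearPotentialTilde hR hMa P.x₁ t) hP.near_pos hP.near_dec hP.u₀'_pos
      (hP.u₀'_pos.le.trans hP.U₁'_ge) (P.x₁ - x)).comp_const_sub P.x₁ x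
    have h := (h1.sub h2).const_mul P.σ
    refine h.congr_deriv ?_
    simp only [lowFreqMultipliers]
    ring
  dχ₁ := fun x ↦ by
    have h := ((hasDerivAt_softStep ((x - P.xN) / P.ℓ)).comp x
      ((hasDerivAt_id x).sub_const P.xN |>.div_const P.ℓ)).const_sub 1
    refine (h.congr_of_eventuallyEq (Eventually.of_forall fun s ↦ rfl)).congr_deriv ?_
    simp only [lowFreqMultipliers]
    ring
  dχ₂ := fun x ↦ by
    have h := (hasDerivAt_softStep ((x - P.xN) / P.ℓ)).comp x
      ((hasDerivAt_id x).sub_const P.xN |>.div_const P.ℓ)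
    refine (h.congr_of_eventuallyEq (Eventually.of_forall fun s ↦ rfl)).congr_deriv ?_
    simp only [lowFreqMultipliers]
    ring

/-! ### Zone values -/

/-- Left of the far zone the far profiles are trivial. [folklore] -/
theorem lowFreq_far_trivial (hP : P.ValidM M a ω m Λ R) {x : ℝ} (hx : x - P.x₀ ≤ P.T - 1) :
    lowFreqWeight (farPotentialM M a ω m Λ R P.x₀) P.T P.ε P.u₀ P.U₁ (x - P.x₀) = 0 ∧
      lowFreqWeightDeriv (farPotentialM M a ω m Λ R P.x₀) (farPotentialMDeriv M a ω m Λ R P.x₀)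
        P.T P.ε P.u₀ P.U₁ (x - P.x₀) = 0 ∧
      lowFreqCutoff P.p (2 * P.T) (x - P.x₀) = 1 ∧ lowFreqCutoff₁ P.p (2 * P.T) (x - P.x₀) = 0 ∧
      lowFreqCutoff₂ P.p (2 * P.T) (x - P.x₀) = 0 := by
  have hT : 0 < 2 * P.T := by linarith [hP.T_gt]
  have hle : x - P.x₀ ≤ 2 * P.T := by linarith [hP.T_gt]
  have hw := lowFreqWeight_of_le (W := farPotentialM M a ω m Λ R P.x₀)
    (W₁ := farPotentialMDeriv M a ω m Λ R P.x₀) (T := P.T) (ε := P.ε) hP.u₀_pos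
    (hP.u₀_pos.le.trans hP.U₁_ge) hx
  exact ⟨hw.1, hw.2, lowFreqCutoff_eq_one hT hle, lowFreqCutoff₁_eq_zero_of_le hT hle,
    lowFreqCutoff₂_eq_zero_of_le hT hle⟩

/-- Right of the near zone the near profiles are trivial. [folklore] -/
theorem lowFreq_near_trivial (hP : P.ValidM M a ω m Λ R) {x : ℝ} (hx : P.x₁ - x ≤ P.T' - 1) :
    lowFreqWeight (nearPotentialTilde M a ω m Λ R P.x₁) P.T' P.ε' P.u₀' P.U₁' (P.x₁ - x) = 0 ∧
      lowFreqWeightDeriv (nearPotentialTilde M a ω m Λ R P.x₁) (nearPotentialTildeDeriv M a ω m Λ R P.x₁)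
        P.T' P.ε' P.u₀' P.U₁' (P.x₁ - x) = 0 ∧
      lowFreqCutoff P.p' (2 * P.T') (P.x₁ - x) = 1 ∧
      lowFreqCutoff₁ P.p' (2 * P.T') (P.x₁ - x) = 0 ∧
      lowFreqCutoff₂ P.p' (2 * P.T') (P.x₁ - x) = 0 := by
  have hT : 0 < 2 * P.T' := by linarith [hP.T'_gt]
  have hle : P.x₁ - x ≤ 2 * P.T' := by linarith [hP.T'_gt]
  have hw := lowFreqWeight_of_le (W := nearPotentialTilde M a ω m Λ R P.x₁)
    (W₁ := nearPotentialTildeDeriv M a ω m Λ R P.x₁) (T := P.T') (ε := P.ε') hP.u₀'_pos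
    (hP.u₀'_pos.le.trans hP.U₁'_ge) hx
  exact ⟨hw.1, hw.2, lowFreqCutoff_eq_one hT hle, lowFreqCutoff₁_eq_zero_of_le hT hle,
    lowFreqCutoff₂_eq_zero_of_le hT hle⟩

/-- On `x ≥ x_N` the multipliers `h, y` are the scaled far profiles. [folklore] -/
theorem lowFreq_eq_far (hP : P.ValidM M a ω m Λ R) {x : ℝ} (hx : P.xN ≤ x) :
    (lowFreqMultipliers M a ω m Λ R P).h x = P.σ * lowFreqCutoff P.p (2 * P.T) (x - P.x₀) ∧
      (lowFreqMultipliers M a ω m Λ R P).h' x = P.σ * lowFreqCutoff₁ P.p (2 * P.T) (x - P.x₀) ∧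
      (lowFreqMultipliers M a ω m Λ R P).h'' x = P.σ * lowFreqCutoff₂ P.p (2 * P.T) (x - P.x₀) ∧
      (lowFreqMultipliers M a ω m Λ R P).y x =
        P.σ * lowFreqWeight (farPotentialM M a ω m Λ R P.x₀) P.T P.ε P.u₀ P.U₁ (x - P.x₀) ∧
      (lowFreqMultipliers M a ω m Λ R P).y' x =
        P.σ * lowFreqWeightDeriv (farPotentialM M a ω m Λ R P.x₀) (farPotentialMDeriv M a ω m Λ R P.x₀)
          P.T P.ε P.u₀ P.U₁ (x - P.x₀) := by
  have hx' : P.x₁ - x ≤ P.T' - 1 := by unfold LowFreqParams.xN at hx; linarith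
  obtain ⟨h1, h2, h3, h4, h5⟩ := lowFreq_near_trivial hP hx'
  simp only [lowFreqMultipliers, h1, h2, h3, h4, h5]
  refine ⟨by ring, by ring, by ring, by ring, by ring⟩

/-- On `x ≤ x_b` the multipliers `h, y` are the scaled (reflected) near profiles. [folklore] -/
theorem lowFreq_eq_near (hP : P.ValidM M a ω m Λ R) {x : ℝ} (hx : x ≤ P.xb) :
    (lowFreqMultipliers M a ω m Λ R P).h x = P.σ * lowFreqCutoff P.p' (2 * P.T') (P.x₁ - x) ∧
      (lowFreqMultipliers M a ω m Λ R P).h' x =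
        -(P.σ * lowFreqCutoff₁ P.p' (2 * P.T') (P.x₁ - x)) ∧
      (lowFreqMultipliers M a ω m Λ R P).h'' x =
        P.σ * lowFreqCutoff₂ P.p' (2 * P.T') (P.x₁ - x) ∧
      (lowFreqMultipliers M a ω m Λ R P).y x =
        -(P.σ * lowFreqWeight (nearPotentialTilde M a ω m Λ R P.x₁) P.T' P.ε' P.u₀' P.U₁' (P.x₁ - x)) ∧
      (lowFreqMultipliers M a ω m Λ R P).y' x =
        P.σ * lowFreqWeightDeriv (nearPotentialTilde M a ω m Λ R P.x₁)
          (nearPotentialTildeDeriv M a ω m Λ R P.x₁) P.T' P.ε' P.u₀' P.U₁' (P.x₁ - x) := by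
  have hx' : x - P.x₀ ≤ P.T - 1 := by unfold LowFreqParams.xb at hx; linarith
  obtain ⟨h1, h2, h3, h4, h5⟩ := lowFreq_far_trivial hP hx'
  simp only [lowFreqMultipliers, h1, h2, h3, h4, h5]
  refine ⟨by ring, by ring, by ring, by ring, by ring⟩

/-- In the middle `x_N ≤ x ≤ x_b`: `h = σ`, `h' = h'' = 0`, `y = y' = 0`. [folklore] -/
theorem lowFreq_eq_mid (hP : P.ValidM M a ω m Λ R) {x : ℝ} (hx₁ : P.xN ≤ x) (hx₂ : x ≤ P.xb) :
    (lowFreqMultipliers M a ω m Λ R P).h x = P.σ ∧ (lowFreqMultipliers M a ω m Λ R P).h' x = 0 ∧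
      (lowFreqMultipliers M a ω m Λ R P).h'' x = 0 ∧ (lowFreqMultipliers M a ω m Λ R P).y x = 0 ∧
      (lowFreqMultipliers M a ω m Λ R P).y' x = 0 := by
  obtain ⟨h1, h2, h3, h4, h5⟩ := lowFreq_eq_far hP hx₁
  have hx' : x - P.x₀ ≤ P.T - 1 := by unfold LowFreqParams.xb at hx₂; linarith
  obtain ⟨g1, g2, g3, g4, g5⟩ := lowFreq_far_trivial hP hx'
  rw [h1, h2, h3, h4, h5, g1, g2, g3, g4, g5]
  simp

/-- The cut-offs: `0 ≤ χ₂ ≤ 1`, `χ₁ = 1 − χ₂`, `χ₁' = −χ₂'`, `|χ₂'| ≤ 2/ℓ`, and `χ₂' = 0` off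
`(x_N, x_b)`; `χ₂ = 0` for `x ≤ x_N`, `χ₂ = 1` for `x ≥ x_b`. [folklore] -/
theorem lowFreq_cutoffs (hP : P.ValidM M a ω m Λ R) (x : ℝ) :
    ((lowFreqMultipliers M a ω m Λ R P).χ₂ x ∈ Icc (0 : ℝ) 1 ∧
      (lowFreqMultipliers M a ω m Λ R P).χ₁ x = 1 - (lowFreqMultipliers M a ω m Λ R P).χ₂ x ∧
      (lowFreqMultipliers M a ω m Λ R P).χ₁' x = -(lowFreqMultipliers M a ω m Λ R P).χ₂' x ∧
      |(lowFreqMultipliers M a ω m Λ R P).χ₂' x| ≤ 2 / P.ℓ) ∧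
    ((x ≤ P.xN ∨ P.xb ≤ x) → (lowFreqMultipliers M a ω m Λ R P).χ₂' x = 0) ∧
    (x ≤ P.xN → (lowFreqMultipliers M a ω m Λ R P).χ₂ x = 0) ∧
    (P.xb ≤ x → (lowFreqMultipliers M a ω m Λ R P).χ₂ x = 1) := by
  have hℓ := hP.ℓ_pos
  refine ⟨⟨?_, rfl, rfl, ?_⟩, ?_, ?_, ?_⟩
  · exact softStep_mem_Icc _
  · show |softStepDeriv ((x - P.xN) / P.ℓ) / P.ℓ| ≤ 2 / P.ℓ
    rw [abs_div, abs_of_pos hℓ, div_le_div_iff_of_pos_right hℓ]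
    exact abs_softStepDeriv_le _
  · rintro (h | h)
    · show softStepDeriv ((x - P.xN) / P.ℓ) / P.ℓ = 0
      rw [softStepDeriv_of_nonpos (div_nonpos_of_nonpos_of_nonneg (by linarith) hℓ.le), zero_div]
    · show softStepDeriv ((x - P.xN) / P.ℓ) / P.ℓ = 0
      rw [softStepDeriv_of_one_le, zero_div]
      rw [le_div_iff₀ hℓ]; unfold LowFreqParams.ℓ; linarith
  · intro h
    show softStep ((x - P.xN) / P.ℓ) = 0
    exact softStep_of_nonpos (div_nonpos_of_nonpos_of_nonneg (by linarith) hℓ.le)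
  · intro h
    show softStep ((x - P.xN) / P.ℓ) = 1
    apply softStep_of_one_le
    rw [le_div_iff₀ hℓ]; unfold LowFreqParams.ℓ; linarith

/-- `0 ≤ h ≤ σ` and `|y| ≤ σ·max(Y_F(∞), Y_N(∞))` everywhere (`σ ≥ 0`). [folklore] -/
theorem lowFreq_bounds (hP : P.ValidM M a ω m Λ R) (hσ : 0 ≤ P.σ) (hε : 0 ≤ P.ε) (hε' : 0 ≤ P.ε')
    (x : ℝ) :
    (0 ≤ (lowFreqMultipliers M a ω m Λ R P).h x ∧ (lowFreqMultipliers M a ω m Λ R P).h x ≤ P.σ) ∧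
      |(lowFreqMultipliers M a ω m Λ R P).y x| ≤
        P.σ * max (lowFreqTop P.ε P.u₀ P.U₁) (lowFreqTop P.ε' P.u₀' P.U₁') := by
  rcases le_or_gt P.xN x with h | h
  · obtain ⟨h1, -, -, h4, -⟩ := lowFreq_eq_far hP h
    rw [h1, h4]
    have hc := lowFreqCutoff_mem_Icc P.p (2 * P.T) (x - P.x₀)
    have hw := lowFreqWeight_mem_Icc (W := farPotentialM M a ω m Λ R P.x₀) (T := P.T) hε hP.u₀_pos
      hP.U₁_ge (x - P.x₀)
    refine ⟨⟨mul_nonneg hσ hc.1, mul_le_of_le_one_right hσ hc.2⟩, ?_⟩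
    rw [abs_mul, abs_of_nonneg hσ, abs_of_nonneg hw.1]
    exact mul_le_mul_of_nonneg_left (hw.2.trans (le_max_left _ _)) hσ
  · have h' : x ≤ P.xb := by linarith [hP.xN_lt_xb]
    obtain ⟨h1, -, -, h4, -⟩ := lowFreq_eq_near hP h'
    rw [h1, h4]
    have hc := lowFreqCutoff_mem_Icc P.p' (2 * P.T') (P.x₁ - x)
    have hw := lowFreqWeight_mem_Icc (W := nearPotentialTilde M a ω m Λ R P.x₁) (T := P.T') hε'
      hP.u₀'_pos hP.U₁'_ge (P.x₁ - x)
    refine ⟨⟨mul_nonneg hσ hc.1, mul_le_of_le_one_right hσ hc.2⟩, ?_⟩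
    rw [abs_neg, abs_mul, abs_of_nonneg hσ, abs_of_nonneg hw.1]
    exact mul_le_mul_of_nonneg_left (hw.2.trans (le_max_right _ _)) hσ

end Multipliers

/-! ### The bulk: identity and non-negativity -/

section Bulk

variable {M a ω ϖ Λ E : ℝ} {m : ℤ} {R : ℝ → ℝ} {P : LowFreqParams} {V V' : ℝ → ℝ} {u u₁ : ℝ → ℂ}

/-- The bulk of `Ϙ^h + ϟ^y − E(χ₂Q^T + χ₁Q^K)` with `f = 0`, `χ₁' = −χ₂'`:
`(h + y')|u'|² + (h(V − ω²) − ½h'' + y'(ω² − V) − yV')|u|² − Eχ₂'(ω − ϖ) Im(u'ū)` (the last term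
is the cut-off error of (axisym4)–(axisym6)). [cite: DafermosRodnianskiShlapentokhrothman2014, Prop. 8.7.1 (proof)] -/
theorem combinedBulk_lowFreq (x : ℝ) :
    combinedBulk ω ϖ E V V' (lowFreqMultipliers M a ω m Λ R P) u u₁ x =
      ((lowFreqMultipliers M a ω m Λ R P).h x + (lowFreqMultipliers M a ω m Λ R P).y' x) * ‖u₁ x‖ ^ 2 +
        ((lowFreqMultipliers M a ω m Λ R P).h x * (V x - ω ^ 2) -
            1 / 2 * (lowFreqMultipliers M a ω m Λ R P).h'' x +
            (lowFreqMultipliers M a ω m Λ R P).y' x * (ω ^ 2 - V x) -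
            (lowFreqMultipliers M a ω m Λ R P).y x * V' x) * ‖u x‖ ^ 2 -
        E * ((lowFreqMultipliers M a ω m Λ R P).χ₂' x * (ω - ϖ) * (u₁ x * conj (u x)).im) := by
  simp only [combinedBulk, lowFreqMultipliers, Pi.zero_apply]
  ring

/-- **The hypotheses of the one-sided coefficient inequalities**, far (frequency `ω`) and near
(frequency `ϖ = ω − ω₊m`, potential `W̃`), bundled. [folklore] -/
structure LowFreqParams.CoeffM (M a ω ϖ : ℝ) (m : ℤ) (Λ : ℝ) (R : ℝ → ℝ) (P : LowFreqParams)
    (D₁ D₂ : ℝ) : Prop where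
  ε_pos : 0 < P.ε
  ε'_pos : 0 < P.ε'
  p_le : P.p ≤ 1
  p'_le : P.p' ≤ 1
  pε : P.p * (D₁ + D₂) ≤ 2 * P.ε
  pε' : P.p' * (D₁ + D₂) ≤ 2 * P.ε'
  εK : 5 * P.ε ≤ P.T * farPotentialM M a ω m Λ R P.x₀ P.T
  εK' : 5 * P.ε' ≤ P.T' * nearPotentialTilde M a ω m Λ R P.x₁ P.T'
  u₀_eq : P.u₀ = 1 / 2 / (4 * P.T * farPotentialM M a ω m Λ R P.x₀ P.T)
  u₀'_eq : P.u₀' = 1 / 2 / (4 * P.T' * nearPotentialTilde M a ω m Λ R P.x₁ P.T')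
  U₁_ge : lowFreqF (farPotentialM M a ω m Λ R P.x₀) P.T (2 * P.T * Real.exp (1 / P.p)) ≤ P.U₁
  U₁'_ge : lowFreqF (nearPotentialTilde M a ω m Λ R P.x₁) P.T' (2 * P.T' * Real.exp (1 / P.p')) ≤ P.U₁'
  ω_far : ω ^ 2 ≤ farPotentialM M a ω m Λ R P.x₀ (2 * P.T * Real.exp (1 / P.p))
  ϖ_near : ϖ ^ 2 ≤ nearPotentialTilde M a ω m Λ R P.x₁ (2 * P.T' * Real.exp (1 / P.p'))
  ϖ_eq : ω ^ 2 - sepPotential M a ω m Λ (rPlus M a) = ϖ ^ 2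

/-- **The bulk is non-negative everywhere and `≥ (σ/2)·min(1, v/2)(|u'|² + |u|²)` in the middle**,
provided there `V ≥ v ≥ 2ω²` and the cut-off error is absorbed: `2E|ω − ϖ|/ℓ ≤ σ·min(1, v/2)`.
[cite: DafermosRodnianskiShlapentokhrothman2014, Prop. 8.7.1 (proof)] -/
theorem combinedBulk_lowFreq_nonneg {D₁ D₂ v : ℝ} (hMa : IsSubextremal M a)
    (hR : IsTortoiseRadius M a R) (hP : P.ValidM M a ω m Λ R) (hC : P.CoeffM M a ω ϖ m Λ R D₁ D₂)
    (hσ : 0 ≤ P.σ) (hD₁ : ∀ s, |sharpBump₁ s| ≤ D₁) (hD₂ : ∀ s, |sharpBump₂ s| ≤ D₂)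
    (hv : 0 < v) (hωv : 2 * ω ^ 2 ≤ v) (hVmid : ∀ x, P.xN ≤ x → x ≤ P.xb → v ≤ sepPotential M a ω m Λ (R x))
    (hE : 0 ≤ E) (hcut : 2 * (E * |ω - ϖ|) / P.ℓ ≤ P.σ * min 1 (v / 2)) (x : ℝ) :
    0 ≤ combinedBulk ω ϖ E (fun x ↦ sepPotential M a ω m Λ (R x))
      (fun x ↦ deriv (sepPotential M a ω m Λ) (R x) * (delta M a (R x) / (R x ^ 2 + a ^ 2)))
      (lowFreqMultipliers M a ω m Λ R P) u u₁ x ∧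
    (P.xN ≤ x → x ≤ P.xb → P.σ * min 1 (v / 2) / 2 * (‖u₁ x‖ ^ 2 + ‖u x‖ ^ 2) ≤
      combinedBulk ω ϖ E (fun x ↦ sepPotential M a ω m Λ (R x))
        (fun x ↦ deriv (sepPotential M a ω m Λ) (R x) * (delta M a (R x) / (R x ^ 2 + a ^ 2)))
        (lowFreqMultipliers M a ω m Λ R P) u u₁ x) := by
  rw [combinedBulk_lowFreq]
  have hc : (0 : ℝ) < 1 / 2 := by norm_num
  have hc1 : (1 / 2 : ℝ) ≤ 1 := by norm_num
  obtain ⟨⟨-, -, -, hχb⟩, hχ0, -, -⟩ := lowFreq_cutoffs (M := M) (a := a) (ω := ω) (m := m) (Λ := Λ)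
    (R := R) hP x
  -- the cut-off error term, bounded on the middle and zero outside
  set err := E * ((lowFreqMultipliers M a ω m Λ R P).χ₂' x * (ω - ϖ) * (u₁ x * conj (u x)).im)
    with herr
  have herr_bound : |err| ≤ P.σ * min 1 (v / 2) / 2 * (‖u₁ x‖ ^ 2 + ‖u x‖ ^ 2) := by
    have h1 : |(u₁ x * conj (u x)).im| ≤ ‖u₁ x‖ * ‖u x‖ := by
      calc |(u₁ x * conj (u x)).im| ≤ ‖u₁ x * conj (u x)‖ := Complex.abs_im_le_norm _
        _ = ‖u₁ x‖ * ‖u x‖ := by rw [norm_mul, Complex.norm_conj]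
    have h2 : ‖u₁ x‖ * ‖u x‖ ≤ (‖u₁ x‖ ^ 2 + ‖u x‖ ^ 2) / 2 := by
      nlinarith [sq_nonneg (‖u₁ x‖ - ‖u x‖)]
    rw [herr, abs_mul, abs_mul, abs_mul]
    have hℓ0 : 0 ≤ 2 / P.ℓ := div_nonneg zero_le_two hP.ℓ_pos.le
    have hE1 : |E| * (|(lowFreqMultipliers M a ω m Λ R P).χ₂' x| * |ω - ϖ| * |(u₁ x * conj (u x)).im|) ≤
        |E| * (2 / P.ℓ * |ω - ϖ| * ((‖u₁ x‖ ^ 2 + ‖u x‖ ^ 2) / 2)) := by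
      apply mul_le_mul_of_nonneg_left _ (abs_nonneg E)
      exact mul_le_mul (mul_le_mul_of_nonneg_right hχb (abs_nonneg _)) (h1.trans h2) (abs_nonneg _)
        (mul_nonneg hℓ0 (abs_nonneg _))
    have hE' : |E| * (2 / P.ℓ * |ω - ϖ|) ≤ P.σ * min 1 (v / 2) := by
      rw [abs_of_nonneg hE]
      calc E * (2 / P.ℓ * |ω - ϖ|) = 2 * (E * |ω - ϖ|) / P.ℓ := by ring
        _ ≤ _ := hcut
    calc |E| * (|(lowFreqMultipliers M a ω m Λ R P).χ₂' x| * |ω - ϖ| * |(u₁ x * conj (u x)).im|)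
        ≤ |E| * (2 / P.ℓ * |ω - ϖ| * ((‖u₁ x‖ ^ 2 + ‖u x‖ ^ 2) / 2)) := hE1
      _ = |E| * (2 / P.ℓ * |ω - ϖ|) * ((‖u₁ x‖ ^ 2 + ‖u x‖ ^ 2) / 2) := by ring
      _ ≤ P.σ * min 1 (v / 2) * ((‖u₁ x‖ ^ 2 + ‖u x‖ ^ 2) / 2) :=
          mul_le_mul_of_nonneg_right hE' (by positivity)
      _ = P.σ * min 1 (v / 2) / 2 * (‖u₁ x‖ ^ 2 + ‖u x‖ ^ 2) := by ring
  have herr0 : x ≤ P.xN ∨ P.xb ≤ x → err = 0 := fun h ↦ by rw [herr, hχ0 h]; ring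
  -- the middle estimate (valid for x in the closed middle)
  have hmid : P.xN ≤ x → x ≤ P.xb →
      P.σ * min 1 (v / 2) / 2 * (‖u₁ x‖ ^ 2 + ‖u x‖ ^ 2) ≤
      ((lowFreqMultipliers M a ω m Λ R P).h x + (lowFreqMultipliers M a ω m Λ R P).y' x) * ‖u₁ x‖ ^ 2 +
        ((lowFreqMultipliers M a ω m Λ R P).h x * (sepPotential M a ω m Λ (R x) - ω ^ 2) -
          1 / 2 * (lowFreqMultipliers M a ω m Λ R P).h'' x +
          (lowFreqMultipliers M a ω m Λ R P).y' x * (ω ^ 2 - sepPotential M a ω m Λ (R x)) -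
          (lowFreqMultipliers M a ω m Λ R P).y x *
            (deriv (sepPotential M a ω m Λ) (R x) * (delta M a (R x) / (R x ^ 2 + a ^ 2)))) *
          ‖u x‖ ^ 2 - err := by
    intro hx₁ hx₂
    obtain ⟨e1, -, e3, e4, e5⟩ := lowFreq_eq_mid hP hx₁ hx₂
    rw [e1, e3, e4, e5]
    have hVx := hVmid x hx₁ hx₂
    have h1 : min 1 (v / 2) ≤ 1 := min_le_left _ _
    have h2 : min 1 (v / 2) ≤ sepPotential M a ω m Λ (R x) - ω ^ 2 := by
      have := min_le_right 1 (v / 2); linarith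
    have hmin0 : 0 ≤ min 1 (v / 2) := le_min zero_le_one (by linarith)
    have h3 : P.σ * min 1 (v / 2) * (‖u₁ x‖ ^ 2 + ‖u x‖ ^ 2) ≤
        P.σ * ‖u₁ x‖ ^ 2 + P.σ * (sepPotential M a ω m Λ (R x) - ω ^ 2) * ‖u x‖ ^ 2 := by
      have t1 := mul_le_mul_of_nonneg_right h1 (sq_nonneg ‖u₁ x‖)
      have t2 := mul_le_mul_of_nonneg_right h2 (sq_nonneg ‖u x‖)
      have t3 := mul_le_mul_of_nonneg_left (add_le_add t1 t2) hσ
      nlinarith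
    have h4 := le_abs_self err
    calc P.σ * min 1 (v / 2) / 2 * (‖u₁ x‖ ^ 2 + ‖u x‖ ^ 2)
        ≤ P.σ * min 1 (v / 2) * (‖u₁ x‖ ^ 2 + ‖u x‖ ^ 2) - |err| := by linarith [herr_bound]
      _ ≤ P.σ * ‖u₁ x‖ ^ 2 + P.σ * (sepPotential M a ω m Λ (R x) - ω ^ 2) * ‖u x‖ ^ 2 - err := by
          linarith [h3, h4]
      _ = _ := by ring
  constructor
  · rcases le_or_gt P.xN x with h₁ | h₁
    · rcases lt_or_ge P.xb x with h₂ | h₂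
      · -- far zone proper
        obtain ⟨e1, -, e3, e4, e5⟩ := lowFreq_eq_far hP h₁
        rw [e1, e3, e4, e5, herr0 (Or.inr h₂.le)]
        have h₂' : P.T - 1 ≤ x - P.x₀ := by unfold LowFreqParams.xb at h₂; linarith
        have hco := lowFreq_coeff_nonneg (W := farPotentialM M a ω m Λ R P.x₀)
          (W₁ := farPotentialMDeriv M a ω m Λ R P.x₀) (ϖ := ω) hP.T_gt hc hc1 hC.ε_pos hP.p_pos
          hC.p_le hD₁ hD₂ hC.pε (fun t _ ↦ hasDerivAt_farPotentialM hR hMa P.x₀ t) hP.far_pos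
          hP.far_dec hC.εK hC.u₀_eq hC.U₁_ge hC.ω_far h₂'
        have hY' := lowFreqWeightDeriv_nonneg (W := farPotentialM M a ω m Λ R P.x₀)
          (W₁ := farPotentialMDeriv M a ω m Λ R P.x₀) (ε := P.ε) hc.le hC.ε_pos.le hP.far_pos
          hP.far_dec hP.u₀_pos hP.U₁_ge (x - P.x₀)
        have hh := (lowFreqCutoff_mem_Icc P.p (2 * P.T) (x - P.x₀)).1
        have eW : farPotentialM M a ω m Λ R P.x₀ (x - P.x₀) = sepPotential M a ω m Λ (R x) := by
          simp [farPotentialM]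
        have eW₁ : farPotentialMDeriv M a ω m Λ R P.x₀ (x - P.x₀) =
            deriv (sepPotential M a ω m Λ) (R x) * (delta M a (R x) / (R x ^ 2 + a ^ 2)) := by
          simp [farPotentialMDeriv]
        rw [eW, eW₁] at hco
        have e : ∀ A B C D : ℝ,
            (P.σ * A + P.σ * B) * ‖u₁ x‖ ^ 2 + (P.σ * A * (sepPotential M a ω m Λ (R x) - ω ^ 2) -
              1 / 2 * (P.σ * C) + P.σ * B * (ω ^ 2 - sepPotential M a ω m Λ (R x)) -
              P.σ * D * (deriv (sepPotential M a ω m Λ) (R x) *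
                (delta M a (R x) / (R x ^ 2 + a ^ 2)))) * ‖u x‖ ^ 2 - 0 =
            P.σ * ((A + B) * ‖u₁ x‖ ^ 2 + (A * (sepPotential M a ω m Λ (R x) - ω ^ 2) -
              1 / 2 * C + B * (ω ^ 2 - sepPotential M a ω m Λ (R x)) -
              D * (deriv (sepPotential M a ω m Λ) (R x) *
                (delta M a (R x) / (R x ^ 2 + a ^ 2)))) * ‖u x‖ ^ 2) := fun A B C D ↦ by ring
        rw [e]
        exact mul_nonneg hσ (add_nonneg (mul_nonneg (add_nonneg hh hY') (sq_nonneg _))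
          (mul_nonneg hco (sq_nonneg _)))
      · -- middle
        have h := hmid h₁ h₂
        have : 0 ≤ P.σ * min 1 (v / 2) / 2 * (‖u₁ x‖ ^ 2 + ‖u x‖ ^ 2) := by
          have := le_min zero_le_one (by linarith : (0 : ℝ) ≤ v / 2); positivity
        linarith
    · -- near zone proper: the reflected one-sided lemma with `W̃`, frequency `ϖ`
      obtain ⟨e1, -, e3, e4, e5⟩ := lowFreq_eq_near hP (by linarith [hP.xN_lt_xb] : x ≤ P.xb)
      rw [e1, e3, e4, e5, herr0 (Or.inl h₁.le)]
      have h₁' : P.T' - 1 ≤ P.x₁ - x := by unfold LowFreqParams.xN at h₁; linarith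
      have hco := lowFreq_coeff_nonneg (W := nearPotentialTilde M a ω m Λ R P.x₁)
        (W₁ := nearPotentialTildeDeriv M a ω m Λ R P.x₁) (ϖ := ϖ) hP.T'_gt hc hc1 hC.ε'_pos hP.p'_pos
        hC.p'_le hD₁ hD₂ hC.pε' (fun t _ ↦ hasDerivAt_nearPotentialTilde hR hMa P.x₁ t) hP.near_pos
        hP.near_dec hC.εK' hC.u₀'_eq hC.U₁'_ge hC.ϖ_near h₁'
      have hY' := lowFreqWeightDeriv_nonneg (W := nearPotentialTilde M a ω m Λ R P.x₁)
        (W₁ := nearPotentialTildeDeriv M a ω m Λ R P.x₁) (ε := P.ε') hc.le hC.ε'_pos.le hP.near_pos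
        hP.near_dec hP.u₀'_pos hP.U₁'_ge (P.x₁ - x)
      have hh := (lowFreqCutoff_mem_Icc P.p' (2 * P.T') (P.x₁ - x)).1
      have eW : nearPotentialTilde M a ω m Λ R P.x₁ (P.x₁ - x) =
          sepPotential M a ω m Λ (R x) - sepPotential M a ω m Λ (rPlus M a) := by
        simp [nearPotentialTilde]
      have eW₁ : nearPotentialTildeDeriv M a ω m Λ R P.x₁ (P.x₁ - x) =
          -(deriv (sepPotential M a ω m Λ) (R x) * (delta M a (R x) / (R x ^ 2 + a ^ 2))) := by
        simp [nearPotentialTildeDeriv]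
      rw [eW, eW₁] at hco
      have hϖ := hC.ϖ_eq
      -- V − ω² = Ṽ − ϖ²
      have e : ∀ A B C D : ℝ,
          (P.σ * A + P.σ * B) * ‖u₁ x‖ ^ 2 + (P.σ * A * (sepPotential M a ω m Λ (R x) - ω ^ 2) -
            1 / 2 * (P.σ * C) + P.σ * B * (ω ^ 2 - sepPotential M a ω m Λ (R x)) -
            -(P.σ * D) * (deriv (sepPotential M a ω m Λ) (R x) *
              (delta M a (R x) / (R x ^ 2 + a ^ 2)))) * ‖u x‖ ^ 2 - 0 =
          P.σ * ((A + B) * ‖u₁ x‖ ^ 2 +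
            (A * (sepPotential M a ω m Λ (R x) - sepPotential M a ω m Λ (rPlus M a) -
              (ω ^ 2 - sepPotential M a ω m Λ (rPlus M a))) -
            1 / 2 * C + B * ((ω ^ 2 - sepPotential M a ω m Λ (rPlus M a)) -
              (sepPotential M a ω m Λ (R x) - sepPotential M a ω m Λ (rPlus M a))) -
            D * -(deriv (sepPotential M a ω m Λ) (R x) *
              (delta M a (R x) / (R x ^ 2 + a ^ 2)))) * ‖u x‖ ^ 2) := fun A B C D ↦ by ring
      rw [e, hϖ]
      exact mul_nonneg hσ (add_nonneg (mul_nonneg (add_nonneg hh hY') (sq_nonneg _))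
        (mul_nonneg hco (sq_nonneg _)))
  · exact hmid

end Bulk

/-! ### End limits and integrability of the source -/

section Limits

variable {M a ω ϖ Λ E : ℝ} {m : ℤ} {R : ℝ → ℝ} {P : LowFreqParams} {u u₁ H : ℝ → ℂ}

/-- **End limits at `r* = ∞`**: `h, h' → 0`, `y → σY_F(∞)` (eventually equal), `χ₁ → 0`, `χ₂ → 1`
("`χ₂ = 1, χ₁ = 0, y = 1, ŷ = 0, h = 0` for `r* ≥ R*_∞`"). [cite: DafermosRodnianskiShlapentokhrothman2014, Prop. 8.7.1] -/
theorem endLimits_lowFreq_atTop (hP : P.ValidM M a ω m Λ R) {Ts : ℝ} (hTs : P.T ≤ Ts)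
    (hsat : ∀ t, Ts ≤ t → P.U₁ + 1 ≤ lowFreqF (farPotentialM M a ω m Λ R P.x₀) P.T t) :
    (lowFreqMultipliers M a ω m Λ R P).EndLimits atTop 0 (P.σ * lowFreqTop P.ε P.u₀ P.U₁) 0 1 := by
  have hT : 0 < 2 * P.T := by linarith [hP.T_gt]
  have hexp : 1 ≤ Real.exp (1 / P.p) := Real.one_le_exp (one_div_pos.2 hP.p_pos).le
  set X := max (P.x₀ + 2 * P.T * Real.exp (1 / P.p)) (P.x₀ + Ts) with hX
  have hfar : ∀ x, X ≤ x → P.xb ≤ x := fun x hx ↦ by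
    have h1 : P.x₀ + 2 * P.T * Real.exp (1 / P.p) ≤ x := (le_max_left _ _).trans hx
    unfold LowFreqParams.xb
    nlinarith [hP.T_gt]
  have hfar' : ∀ x, X ≤ x → P.xN ≤ x := fun x hx ↦ by linarith [hfar x hx, hP.xN_lt_xb]
  have hh : ∀ x, X ≤ x → (lowFreqMultipliers M a ω m Λ R P).h x = 0 ∧
      (lowFreqMultipliers M a ω m Λ R P).h' x = 0 := fun x hx ↦ by
    obtain ⟨e1, e2, -, -, -⟩ := lowFreq_eq_far hP (hfar' x hx)
    have hx' : 2 * P.T * Real.exp (1 / P.p) ≤ x - P.x₀ := by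
      have := (le_max_left _ _).trans hx; linarith
    rw [e1, e2, lowFreqCutoff_eq_zero hT hP.p_pos hx', lowFreqCutoff₁_eq_zero_of_ge hT hP.p_pos hx']
    simp
  have hy : ∀ x, X ≤ x → (lowFreqMultipliers M a ω m Λ R P).y x =
      P.σ * lowFreqTop P.ε P.u₀ P.U₁ := fun x hx ↦ by
    obtain ⟨-, -, -, e4, -⟩ := lowFreq_eq_far hP (hfar' x hx)
    have hx' : Ts ≤ x - P.x₀ := by have := (le_max_right _ _).trans hx; linarith
    rw [e4, lowFreqWeight_eq_top hP.u₀_pos hP.U₁_ge (hTs.trans hx') (hsat _ hx')]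
  have hχ : ∀ x, X ≤ x → (lowFreqMultipliers M a ω m Λ R P).χ₁ x = 0 ∧
      (lowFreqMultipliers M a ω m Λ R P).χ₂ x = 1 := fun x hx ↦ by
    obtain ⟨⟨-, e1, -, -⟩, -, -, e2⟩ := lowFreq_cutoffs (M := M) (a := a) (ω := ω) (m := m) (Λ := Λ)
      (R := R) hP x
    rw [e1, e2 (hfar x hx)]
    simp
  refine ⟨tendsto_const_nhds, ⟨0, tendsto_const_nhds⟩, tendsto_const_nhds, ⟨0, ?_⟩, ?_, ?_, ?_, ?_⟩
  · exact tendsto_const_nhds.congr' (by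
      filter_upwards [eventually_ge_atTop X] with x hx using ((hh x hx).1).symm)
  · exact tendsto_const_nhds.congr' (by
      filter_upwards [eventually_ge_atTop X] with x hx using ((hh x hx).2).symm)
  · exact tendsto_const_nhds.congr' (by
      filter_upwards [eventually_ge_atTop X] with x hx using (hy x hx).symm)
  · exact tendsto_const_nhds.congr' (by
      filter_upwards [eventually_ge_atTop X] with x hx using ((hχ x hx).1).symm)
  · exact tendsto_const_nhds.congr' (by
      filter_upwards [eventually_ge_atTop X] with x hx using ((hχ x hx).2).symm)

/-- **End limits at the horizon end**: `h, h' → 0`, `y → −σY_N(∞)`, `χ₁ → 1`, `χ₂ → 0`.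
[cite: DafermosRodnianskiShlapentokhrothman2014, Prop. 8.7.1] -/
theorem endLimits_lowFreq_atBot (hP : P.ValidM M a ω m Λ R) {Ts' : ℝ} (hTs' : P.T' ≤ Ts')
    (hsat' : ∀ t, Ts' ≤ t → P.U₁' + 1 ≤ lowFreqF (nearPotentialTilde M a ω m Λ R P.x₁) P.T' t) :
    (lowFreqMultipliers M a ω m Λ R P).EndLimits atBot 0 (-(P.σ * lowFreqTop P.ε' P.u₀' P.U₁'))
      1 0 := by
  have hT : 0 < 2 * P.T' := by linarith [hP.T'_gt]
  have hexp : 1 ≤ Real.exp (1 / P.p') := Real.one_le_exp (one_div_pos.2 hP.p'_pos).le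
  set X := min (P.x₁ - 2 * P.T' * Real.exp (1 / P.p')) (P.x₁ - Ts') with hX
  have hnear : ∀ x, x ≤ X → x ≤ P.xN := fun x hx ↦ by
    have h1 : x ≤ P.x₁ - 2 * P.T' * Real.exp (1 / P.p') := hx.trans (min_le_left _ _)
    unfold LowFreqParams.xN
    nlinarith [hP.T'_gt]
  have hnear' : ∀ x, x ≤ X → x ≤ P.xb := fun x hx ↦ by linarith [hnear x hx, hP.xN_lt_xb]
  have hh : ∀ x, x ≤ X → (lowFreqMultipliers M a ω m Λ R P).h x = 0 ∧
      (lowFreqMultipliers M a ω m Λ R P).h' x = 0 := fun x hx ↦ by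
    obtain ⟨e1, e2, -, -, -⟩ := lowFreq_eq_near hP (hnear' x hx)
    have hx' : 2 * P.T' * Real.exp (1 / P.p') ≤ P.x₁ - x := by
      have := hx.trans (min_le_left _ _); linarith
    rw [e1, e2, lowFreqCutoff_eq_zero hT hP.p'_pos hx', lowFreqCutoff₁_eq_zero_of_ge hT hP.p'_pos hx']
    simp
  have hy : ∀ x, x ≤ X → (lowFreqMultipliers M a ω m Λ R P).y x =
      -(P.σ * lowFreqTop P.ε' P.u₀' P.U₁') := fun x hx ↦ by
    obtain ⟨-, -, -, e4, -⟩ := lowFreq_eq_near hP (hnear' x hx)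
    have hx' : Ts' ≤ P.x₁ - x := by have := hx.trans (min_le_right _ _); linarith
    rw [e4, lowFreqWeight_eq_top hP.u₀'_pos hP.U₁'_ge (hTs'.trans hx') (hsat' _ hx')]
  have hχ : ∀ x, x ≤ X → (lowFreqMultipliers M a ω m Λ R P).χ₁ x = 1 ∧
      (lowFreqMultipliers M a ω m Λ R P).χ₂ x = 0 := fun x hx ↦ by
    obtain ⟨⟨-, e1, -, -⟩, -, e2, -⟩ := lowFreq_cutoffs (M := M) (a := a) (ω := ω) (m := m) (Λ := Λ)
      (R := R) hP x
    rw [e1, e2 (hnear x hx)]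
    simp
  refine ⟨tendsto_const_nhds, ⟨0, tendsto_const_nhds⟩, tendsto_const_nhds, ⟨0, ?_⟩, ?_, ?_, ?_, ?_⟩
  · exact tendsto_const_nhds.congr' (by
      filter_upwards [eventually_le_atBot X] with x hx using ((hh x hx).1).symm)
  · exact tendsto_const_nhds.congr' (by
      filter_upwards [eventually_le_atBot X] with x hx using ((hh x hx).2).symm)
  · exact tendsto_const_nhds.congr' (by
      filter_upwards [eventually_le_atBot X] with x hx using (hy x hx).symm)
  · exact tendsto_const_nhds.congr' (by
      filter_upwards [eventually_le_atBot X] with x hx using ((hχ x hx).1).symm)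
  · exact tendsto_const_nhds.congr' (by
      filter_upwards [eventually_le_atBot X] with x hx using ((hχ x hx).2).symm)

/-- The source term of `Ϙ^h + ϟ^y − E(χ₂Q^T + χ₁Q^K)`:
`−h Re(uH̄) − 2y Re(u'H̄) + E(χ₂ω + χ₁ϖ) Im(Hū)`. [cite: DafermosRodnianskiShlapentokhrothman2014, Prop. 8.7.1] -/
theorem combinedSource_lowFreq (x : ℝ) :
    combinedSource ω ϖ E (lowFreqMultipliers M a ω m Λ R P) u u₁ H x =
      -((lowFreqMultipliers M a ω m Λ R P).h x * ⟪H x, u x⟫_ℝ) -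
        2 * (lowFreqMultipliers M a ω m Λ R P).y x * ⟪H x, u₁ x⟫_ℝ +
        E * (((lowFreqMultipliers M a ω m Λ R P).χ₂ x * ω +
          (lowFreqMultipliers M a ω m Λ R P).χ₁ x * ϖ) * (H x * conj (u x)).im) := by
  have hf : (lowFreqMultipliers M a ω m Λ R P).f x = 0 := rfl
  have hf' : (lowFreqMultipliers M a ω m Λ R P).f' x = 0 := rfl
  simp only [combinedSource, hf, hf']
  ring

/-- **The source is integrable** when `Re(u'H̄)` and `Im(Hū)` are (and `H` is continuous).
[folklore] -/
theorem integrable_combinedSource_lowFreq (hMa : IsSubextremal M a) (hR : IsTortoiseRadius M a R)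
    (hP : P.ValidM M a ω m Λ R) (hσ : 0 ≤ P.σ) (hε : 0 ≤ P.ε) (hε' : 0 ≤ P.ε')
    (hu : ∀ x, HasDerivAt u (u₁ x) x) (hH : Continuous H)
    (hS₁ : Integrable fun x ↦ ⟪H x, u₁ x⟫_ℝ) (hS₂ : Integrable fun x ↦ (H x * conj (u x)).im) :
    Integrable (combinedSource ω ϖ E (lowFreqMultipliers M a ω m Λ R P) u u₁ H) := by
  have hμ := hasDerivs_lowFreqMultipliers hMa hR hP
  have huc : Continuous u := continuous_iff_continuousAt.2 fun x ↦ (hu x).continuousAt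
  have hhc : Continuous (lowFreqMultipliers M a ω m Λ R P).h :=
    continuous_iff_continuousAt.2 fun x ↦ (hμ.dh x).continuousAt
  have hyc : Continuous (lowFreqMultipliers M a ω m Λ R P).y :=
    continuous_iff_continuousAt.2 fun x ↦ (hμ.dy x).continuousAt
  have hχ₁c : Continuous (lowFreqMultipliers M a ω m Λ R P).χ₁ :=
    continuous_iff_continuousAt.2 fun x ↦ (hμ.dχ₁ x).continuousAt
  have hχ₂c : Continuous (lowFreqMultipliers M a ω m Λ R P).χ₂ :=
    continuous_iff_continuousAt.2 fun x ↦ (hμ.dχ₂ x).continuousAt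
  have hT : 0 < 2 * P.T := by linarith [hP.T_gt]
  have hT' : 0 < 2 * P.T' := by linarith [hP.T'_gt]
  -- `h ⟪H, u⟫` : continuous with compact support
  have hI₁ : Integrable fun x ↦ (lowFreqMultipliers M a ω m Λ R P).h x * ⟪H x, u x⟫_ℝ := by
    refine Continuous.integrable_of_hasCompactSupport (hhc.mul (hH.inner huc)) ?_
    refine HasCompactSupport.intro (isCompact_Icc (a := P.x₁ - 2 * P.T' * Real.exp (1 / P.p'))
      (b := P.x₀ + 2 * P.T * Real.exp (1 / P.p))) fun x hx ↦ ?_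
    rw [mem_Icc, not_and_or, not_le, not_le] at hx
    have hexp : 1 ≤ Real.exp (1 / P.p) := Real.one_le_exp (one_div_pos.2 hP.p_pos).le
    have hexp' : 1 ≤ Real.exp (1 / P.p') := Real.one_le_exp (one_div_pos.2 hP.p'_pos).le
    have hzone := hP.xN_lt_xb
    unfold LowFreqParams.xN LowFreqParams.xb at hzone
    rcases hx with hx | hx
    · have h₀ : x ≤ P.xb := by unfold LowFreqParams.xb; nlinarith [hP.T'_gt]
      obtain ⟨e1, -, -, -, -⟩ := lowFreq_eq_near hP h₀
      rw [e1, lowFreqCutoff_eq_zero hT' hP.p'_pos (by linarith)]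
      simp
    · have h₁ : P.xN ≤ x := by unfold LowFreqParams.xN; nlinarith [hP.T_gt]
      obtain ⟨e1, -, -, -, -⟩ := lowFreq_eq_far hP h₁
      rw [e1, lowFreqCutoff_eq_zero hT hP.p_pos (by linarith)]
      simp
  -- `2y ⟪H, u'⟫` : bounded continuous times integrable
  set B := P.σ * max (lowFreqTop P.ε P.u₀ P.U₁) (lowFreqTop P.ε' P.u₀' P.U₁') with hB
  have hyc2 : Continuous fun x ↦ 2 * (lowFreqMultipliers M a ω m Λ R P).y x := continuous_const.mul hyc
  have hI₂ : Integrable fun x ↦ 2 * (lowFreqMultipliers M a ω m Λ R P).y x * ⟪H x, u₁ x⟫_ℝ := by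
    refine hS₁.bdd_mul (c := 2 * B) hyc2.aestronglyMeasurable (Eventually.of_forall fun x ↦ ?_)
    have hb := (lowFreq_bounds hP hσ hε hε' x).2
    rw [Real.norm_eq_abs, abs_mul, abs_two]
    linarith
  -- the `χ` term : bounded continuous times integrable
  have hχc : Continuous fun x ↦ E * ((lowFreqMultipliers M a ω m Λ R P).χ₂ x * ω +
      (lowFreqMultipliers M a ω m Λ R P).χ₁ x * ϖ) := by fun_prop
  have hI₃ : Integrable fun x ↦ E * ((lowFreqMultipliers M a ω m Λ R P).χ₂ x * ω +
      (lowFreqMultipliers M a ω m Λ R P).χ₁ x * ϖ) * (H x * conj (u x)).im := by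
    refine hS₂.bdd_mul (c := |E| * (|ω| + |ϖ|)) hχc.aestronglyMeasurable
      (Eventually.of_forall fun x ↦ ?_)
    obtain ⟨⟨h2, h1, -, -⟩, -, -, -⟩ := lowFreq_cutoffs (M := M) (a := a) (ω := ω) (m := m) (Λ := Λ)
      (R := R) hP x
    rw [Real.norm_eq_abs, abs_mul, h1]
    apply mul_le_mul_of_nonneg_left _ (abs_nonneg E)
    calc |(lowFreqMultipliers M a ω m Λ R P).χ₂ x * ω +
          (1 - (lowFreqMultipliers M a ω m Λ R P).χ₂ x) * ϖ|
        ≤ |(lowFreqMultipliers M a ω m Λ R P).χ₂ x * ω| +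
          |(1 - (lowFreqMultipliers M a ω m Λ R P).χ₂ x) * ϖ| := abs_add_le _ _
      _ = (lowFreqMultipliers M a ω m Λ R P).χ₂ x * |ω| +
          (1 - (lowFreqMultipliers M a ω m Λ R P).χ₂ x) * |ϖ| := by
          rw [abs_mul, abs_mul, abs_of_nonneg h2.1, abs_of_nonneg (sub_nonneg.2 h2.2)]
      _ ≤ |ω| + |ϖ| := by
          nlinarith [h2.1, h2.2, abs_nonneg ω, abs_nonneg ϖ]
  have h := (hI₁.neg.sub hI₂).add hI₃
  refine h.congr (Eventually.of_forall fun x ↦ ?_)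
  simp only [Pi.add_apply, Pi.sub_apply, Pi.neg_apply]
  rw [combinedSource_lowFreq]
  ring

end Limits

/-! ### The estimate for given parameters -/

section Estimate

variable {M a ω ϖ Λ : ℝ} {m : ℤ} {R : ℝ → ℝ} {P : LowFreqParams}

/-- **Proposition 8.7.1 for given parameters.** In the situation of `ValidM`, `CoeffM` (incl.
`ω² − V(r₊) = ϖ²`), normalisation `σY_F(∞) = 1`, `Y_N(∞) ≤ Y_F(∞)`, saturation thresholds, a middle
lower bound `V ≥ v ≥ 2ω²` on `[x_N, x_b]`, absorbed cut-off error `2E|ω − ϖ|/ℓ ≤ σmin(1, v/2)`, and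
`E ≥ 2`: for every solution of `u'' + (ω² − V)u = H` with `u' − iωu → 0` at `+∞`,
`u' + iϖu → 0` at `−∞`, `|u|² → A_∞, A_H`:
`(σ/2)·min(1, v/2) ∫_{x₁'}^{x₂'} (|u'|² + |u|²) ≤ ∫ (−hRe(uH̄) − 2yRe(u'H̄) + E(χ₂ω + χ₁ϖ)Im(Hū))`
for `[x₁', x₂'] ⊂ [x_N, x_b]`. [cite: DafermosRodnianskiShlapentokhrothman2014, Prop. 8.7.1] -/
theorem lowFreq_estimate_of_params {D₁ D₂ Ts Ts' v x₁' x₂' E Atop Abot : ℝ}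
    {u u₁ u₂ H : ℝ → ℂ} (hMa : IsSubextremal M a) (hR : IsTortoiseRadius M a R)
    (hadm : IsAdmissibleTriple a ω m Λ) (hP : P.ValidM M a ω m Λ R)
    (hC : P.CoeffM M a ω ϖ m Λ R D₁ D₂)
    (hD₁ : ∀ s, |sharpBump₁ s| ≤ D₁) (hD₂ : ∀ s, |sharpBump₂ s| ≤ D₂) (hσ : 0 < P.σ)
    (hnorm : P.σ * lowFreqTop P.ε P.u₀ P.U₁ = 1)
    (htop : lowFreqTop P.ε' P.u₀' P.U₁' ≤ lowFreqTop P.ε P.u₀ P.U₁) (hTs : P.T ≤ Ts)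
    (hsat : ∀ t, Ts ≤ t → P.U₁ + 1 ≤ lowFreqF (farPotentialM M a ω m Λ R P.x₀) P.T t)
    (hTs' : P.T' ≤ Ts')
    (hsat' : ∀ t, Ts' ≤ t → P.U₁' + 1 ≤ lowFreqF (nearPotentialTilde M a ω m Λ R P.x₁) P.T' t)
    (hv : 0 < v) (hωv : 2 * ω ^ 2 ≤ v) (hx : x₁' ≤ x₂') (hx₁' : P.xN ≤ x₁') (hx₂' : x₂' ≤ P.xb)
    (hVmid : ∀ x, P.xN ≤ x → x ≤ P.xb → v ≤ sepPotential M a ω m Λ (R x))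
    (hE : 2 ≤ E) (hcut : 2 * (E * |ω - ϖ|) / P.ℓ ≤ P.σ * min 1 (v / 2))
    (hu : ∀ x, HasDerivAt u (u₁ x) x) (hu₁ : ∀ x, HasDerivAt u₁ (u₂ x) x)
    (hode : ∀ x, u₂ x + ((ω ^ 2 - sepPotential M a ω m Λ (R x) : ℝ) : ℂ) * u x = H x)
    (hH : Continuous H) (hS₁ : Integrable fun x ↦ ⟪H x, u₁ x⟫_ℝ)
    (hS₂ : Integrable fun x ↦ (H x * conj (u x)).im)
    (hb_top : Tendsto (fun x ↦ u₁ x - Complex.I * ω * u x) atTop (𝓝 0))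
    (hb_bot : Tendsto (fun x ↦ u₁ x + Complex.I * ϖ * u x) atBot (𝓝 0))
    (hA_top : Tendsto (fun x ↦ ‖u x‖ ^ 2) atTop (𝓝 Atop))
    (hA_bot : Tendsto (fun x ↦ ‖u x‖ ^ 2) atBot (𝓝 Abot)) :
    P.σ * min 1 (v / 2) / 2 * ∫ x in x₁'..x₂', (‖u₁ x‖ ^ 2 + ‖u x‖ ^ 2) ≤
      ∫ x, combinedSource ω ϖ E (lowFreqMultipliers M a ω m Λ R P) u u₁ H x := by
  have hM := hMa.pos
  set V : ℝ → ℝ := fun x ↦ sepPotential M a ω m Λ (R x) with hVdef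
  set V₁ : ℝ → ℝ := fun x ↦ deriv (sepPotential M a ω m Λ) (R x) *
    (delta M a (R x) / (R x ^ 2 + a ^ 2)) with hV₁def
  have hV : ∀ x, HasDerivAt V (V₁ x) x := fun x ↦ hasDerivAt_sepPotential_comp hR hMa x
  have hμ := hasDerivs_lowFreqMultipliers hMa hR hP
  have hS := integrable_combinedSource_lowFreq (ϖ := ϖ) (E := E) hMa hR hP hσ.le hC.ε_pos.le
    hC.ε'_pos.le hu hH hS₁ hS₂
  -- boundary behaviour
  have hV_top : Tendsto V atTop (𝓝 0) := tendsto_sepPotential_comp_atTop hR hMa hadm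
  have hV_bot : Tendsto V atBot (𝓝 (ω ^ 2 - ϖ ^ 2)) := by
    have h := tendsto_sepPotential_comp_atBot (ω := ω) (m := m) (Λ := Λ) hR hMa
    have e : ω ^ 2 - (ω - horizonAngularVelocity M a * m) ^ 2 = ω ^ 2 - ϖ ^ 2 := by
      have h1 := omega_sq_sub_sepPotential_rPlus (le_of_lt hMa) hM ω m Λ
      have h2 := hC.ϖ_eq
      have h3 := horizonAngularVelocity_mul_sq M a m
      -- V(r₊) = ω² − (ω − ω₊ m)² and V(r₊) = ω² − ϖ²
      have h4 : (ω - horizonAngularVelocity M a * m) ^ 2 =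
          (2 * M * rPlus M a * ω - a * m) ^ 2 / (4 * M ^ 2 * rPlus M a ^ 2) := by
        have hrp0 : 0 < rPlus M a := hM.trans_le (M_le_rPlus M a)
        unfold horizonAngularVelocity
        field_simp
        ring
      rw [h4]
      linarith
    rw [e] at h
    exact h
  have hb : OutgoingBoundary ω ϖ V u u₁ Atop Abot :=
    ⟨hb_top, hb_bot, hA_top, hA_bot, hV_top, hV_bot⟩
  have htopL := endLimits_lowFreq_atTop hP hTs hsat
  have hbotL := endLimits_lowFreq_atBot hP hTs' hsat'
  have hbulk := fun x ↦ combinedBulk_lowFreq_nonneg (E := E) (u := u) (u₁ := u₁) hMa hR hP hC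
    hσ.le hD₁ hD₂ hv hωv hVmid (by linarith) hcut x
  have hP0 : ∀ x, 0 ≤ combinedBulk ω ϖ E V V₁ (lowFreqMultipliers M a ω m Λ R P) u u₁ x :=
    fun x ↦ (hbulk x).1
  have hcoer : ∀ x ∈ Icc x₁' x₂',
      P.σ * min 1 (v / 2) / 2 * (‖u₁ x‖ ^ 2 + (fun _ ↦ (1 : ℝ)) x * ‖u x‖ ^ 2) ≤
      combinedBulk ω ϖ E V V₁ (lowFreqMultipliers M a ω m Λ R P) u u₁ x := by
    intro x hx'
    have h := (hbulk x).2 (by linarith [hx'.1]) (by linarith [hx'.2])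
    simpa using h
  have hsign_top : 2 * (0 + P.σ * lowFreqTop P.ε P.u₀ P.U₁) * ω ^ 2 ≤
      E * (1 * ω ^ 2 + 0 * ϖ * ω) := by
    rw [hnorm]; nlinarith [sq_nonneg ω]
  have hsign_bot : 0 ≤ 2 * (0 + -(P.σ * lowFreqTop P.ε' P.u₀' P.U₁')) * ϖ ^ 2 +
      E * (0 * ω * ϖ + 1 * ϖ ^ 2) := by
    have : P.σ * lowFreqTop P.ε' P.u₀' P.U₁' ≤ 1 := by
      rw [← hnorm]; exact mul_le_mul_of_nonneg_left htop hσ.le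
    nlinarith [sq_nonneg ϖ]
  have h := combined_estimate_of_boundary_sign (b := P.σ * min 1 (v / 2) / 2) hV hμ hu hu₁ hode hH
    hS hb htopL hbotL hP0 continuous_const hx hcoer hsign_top hsign_bot
  simpa using h

end Estimate

/-! ### Saturation and the far end, general `m` -/

section Saturation

variable {M a ω ωl Λ Λ₁ : ℝ} {m : ℤ} {R : ℝ → ℝ}

/-- Far saturation for general `m` (as `axi_far_saturation`). [folklore] -/
theorem far_saturation_smallA (hM : 0 < M) (ha0 : 0 ≤ a) (ha2 : 2 * a ≤ M)
    (hR : IsTortoiseRadius M a R) {Rb' xb x₀ T U t : ℝ} (hRb : 20 * M ≤ Rb') (hxb : R xb = Rb')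
    (hx₀ : x₀ = xb - Rb') (hT : T = Rb' + 1) (hadm : IsAdmissibleTriple a ω m Λ) (hΛ : Λ ≤ Λ₁)
    (hω : |ω| ≤ ωl) (hsmall : 20 * (a * ωl) ≤ 1)
    (ht : max T (12 * (Λ₁ + 1) * (U + 1 + 2 * T ^ 2 / M)) ≤ t) :
    U + 1 ≤ lowFreqF (farPotentialM M a ω m Λ R x₀) T t := by
  have hΛ0 := hadm.nonneg
  have hΛ₁ : 0 ≤ Λ₁ := hΛ0.trans hΛ
  have hT1 : T - 1 ≤ t := by have := (le_max_left _ _).trans ht; linarith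
  have hT0 : 0 < T := by rw [hT]; linarith
  have ht0 : 0 < t := by linarith
  obtain ⟨-, hWt, -, -⟩ := far_data_smallA hM ha0 ha2 hR hRb hxb hx₀ hT hadm hω hsmall hT1
  obtain ⟨-, hWT, -, hWTlo⟩ := far_data_smallA hM ha0 ha2 hR hRb hxb hx₀ hT hadm hω hsmall
    (t := T) (by linarith)
  have hup : farPotentialM M a ω m Λ R x₀ t ≤ 12 * (Λ₁ + 1) / t ^ 2 :=
    (farPotentialM_le hM ha0 ha2 hR hRb hxb hx₀ hT hadm hT1).trans (by gcongr)
  unfold lowFreqF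
  have h1 : t / (12 * (Λ₁ + 1)) ≤ 1 / (t * farPotentialM M a ω m Λ R x₀ t) := by
    rw [div_le_div_iff₀ (by positivity) (by positivity)]
    have := mul_le_mul_of_nonneg_left hup (by positivity : (0 : ℝ) ≤ t ^ 2)
    have e : t ^ 2 * (12 * (Λ₁ + 1) / t ^ 2) = 12 * (Λ₁ + 1) := by field_simp
    nlinarith
  have h2 : 1 / (T * farPotentialM M a ω m Λ R x₀ T) ≤ 2 * T ^ 2 / M := by
    rw [div_le_div_iff₀ (by positivity) hM]
    have := mul_le_mul_of_nonneg_left hWTlo (by positivity : (0 : ℝ) ≤ 2 * T ^ 3)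
    have e : 2 * T ^ 3 * (M / (2 * T ^ 3)) = M := by field_simp
    nlinarith
  have h3 : 12 * (Λ₁ + 1) * (U + 1 + 2 * T ^ 2 / M) ≤ t := (le_max_right _ _).trans ht
  have h4 : U + 1 + 2 * T ^ 2 / M ≤ t / (12 * (Λ₁ + 1)) := by
    rw [le_div_iff₀ (by positivity)]; linarith
  linarith

set_option maxHeartbeats 400000 in
/-- Near saturation for general `m` (as `axi_near_saturation`, for `W̃`). [folklore] -/
theorem near_saturation_smallA (hM : 0 < M) (ha0 : 0 ≤ a) (ha2 : 2 * a ≤ M)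
    (hR : IsTortoiseRadius M a R) {sN xN x₁ T' U t : ℝ} (hadm : IsAdmissibleTriple a ω m Λ)
    (hΛ : Λ ≤ Λ₁) (hω : |ω| ≤ ωl) (hsmall : 20 * (a * ωl) ≤ 1) (hsN : 0 < sN)
    (hsNL : sN * horizonCurv M a Λ₁ ≤ horizonSlope M a / 2) (hsNr : sN ≤ rPlus M a)
    (hxN : R xN = rPlus M a + sN) (hT' : nearThreshold M a Λ₁ + 2 ≤ T')
    (hx₁ : x₁ = xN + T' - 1)
    (ht : max (2 * T') (8 * horizonDerivBound M a Λ₁ * sN *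
      (U + 1 + 2 * Real.exp (1 / M) / (T' * horizonSlope M a * sN)) /
      (√(M ^ 2 - a ^ 2) / (4 * rPlus M a ^ 2)) ^ 2) ≤ t) :
    U + 1 ≤ lowFreqF (nearPotentialTilde M a ω m Λ R x₁) T' t := by
  have hMa : IsSubextremal M a := by unfold IsSubextremal; rw [abs_of_nonneg ha0]; linarith
  have hrp0 : 0 < rPlus M a := hM.trans_le (M_le_rPlus M a)
  have hΛ₁ : 0 ≤ Λ₁ := hadm.nonneg.trans hΛ
  have hκ := horizonSlope_pos hMa
  have hκ₂ := horizonDerivBound_pos hMa hΛ₁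
  have hT₀ := (horizonDerivBound_nonneg hMa hΛ₁).2
  have hsq : 0 < M ^ 2 - a ^ 2 := by nlinarith
  set c₁ := √(M ^ 2 - a ^ 2) / (4 * rPlus M a ^ 2) with hc₁
  have hc₁0 : 0 < c₁ := by rw [hc₁]; exact div_pos (Real.sqrt_pos.2 hsq) (by positivity)
  have hT'1 : 1 < T' := by linarith
  have hT'0 : 0 < T' := by linarith
  have ht2 : 2 * T' ≤ t := (le_max_left _ _).trans ht
  have htT : T' - 1 ≤ t := by linarith
  have ht0 : 0 < t := by linarith
  obtain ⟨-, hWpos, -, ⟨-, hWup⟩, ⟨-, hRup⟩⟩ :=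
    near_data_smallA hM ha0 ha2 hR hadm hΛ hω hsmall hsN hsNL hsNr hxN hT' hx₁ htT
  obtain ⟨-, hWTpos, -, ⟨hWTlo, -⟩, ⟨hRTlo, -⟩⟩ :=
    near_data_smallA hM ha0 ha2 hR hadm hΛ hω hsmall hsN hsNL hsNr hxN hT' hx₁ (t := T')
      (by linarith)
  set τ := t - (T' - 1) with hτ
  have hτ0 : 0 ≤ τ := by rw [hτ]; linarith
  have hτt : t / 2 ≤ τ := by rw [hτ]; linarith
  have hW : nearPotentialTilde M a ω m Λ R x₁ t ≤
      horizonDerivBound M a Λ₁ * sN * Real.exp (-c₁ * τ) := by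
    refine hWup.trans ?_
    rw [mul_assoc]
    exact mul_le_mul_of_nonneg_left hRup hκ₂.le
  have hexp : c₁ ^ 2 * t ^ 2 / 8 ≤ Real.exp (c₁ * τ) := by
    have h := Real.quadratic_le_exp_of_nonneg (mul_nonneg hc₁0.le hτ0)
    have : c₁ ^ 2 * t ^ 2 / 8 ≤ (c₁ * τ) ^ 2 / 2 := by
      rw [div_le_div_iff₀ (by norm_num) (by norm_num)]
      have := mul_le_mul hτt hτt (by linarith) hτ0
      nlinarith [sq_nonneg c₁]
    nlinarith [mul_nonneg hc₁0.le hτ0]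
  have h1 : c₁ ^ 2 * t / (8 * horizonDerivBound M a Λ₁ * sN) ≤
      1 / (t * nearPotentialTilde M a ω m Λ R x₁ t) := by
    rw [div_le_div_iff₀ (by positivity) (by positivity)]
    have hE : Real.exp (-c₁ * τ) * Real.exp (c₁ * τ) = 1 := by
      rw [← Real.exp_add]; simp
    have hpos : 0 < Real.exp (-c₁ * τ) := Real.exp_pos _
    have h2 : c₁ ^ 2 * t ^ 2 / 8 * Real.exp (-c₁ * τ) ≤ 1 := by
      calc c₁ ^ 2 * t ^ 2 / 8 * Real.exp (-c₁ * τ)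
          ≤ Real.exp (c₁ * τ) * Real.exp (-c₁ * τ) := mul_le_mul_of_nonneg_right hexp hpos.le
        _ = 1 := by rw [mul_comm, hE]
    have h3 := mul_le_mul_of_nonneg_left hW (by positivity : (0 : ℝ) ≤ c₁ ^ 2 * t ^ 2)
    calc c₁ ^ 2 * t * (t * nearPotentialTilde M a ω m Λ R x₁ t)
        = c₁ ^ 2 * t ^ 2 * nearPotentialTilde M a ω m Λ R x₁ t := by ring
      _ ≤ c₁ ^ 2 * t ^ 2 * (horizonDerivBound M a Λ₁ * sN * Real.exp (-c₁ * τ)) := h3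
      _ = (8 * horizonDerivBound M a Λ₁ * sN) * (c₁ ^ 2 * t ^ 2 / 8 * Real.exp (-c₁ * τ)) := by ring
      _ ≤ (8 * horizonDerivBound M a Λ₁ * sN) * 1 := by gcongr
      _ = 1 * (8 * horizonDerivBound M a Λ₁ * sN) := by ring
  have h2 : 1 / (T' * nearPotentialTilde M a ω m Λ R x₁ T') ≤
      2 * Real.exp (1 / M) / (T' * horizonSlope M a * sN) := by
    have hlo : horizonSlope M a / 2 * (sN * Real.exp (-(T' - (T' - 1)) / M)) ≤
        nearPotentialTilde M a ω m Λ R x₁ T' :=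
      le_trans (mul_le_mul_of_nonneg_left hRTlo (by positivity)) hWTlo
    have e1 : -(T' - (T' - 1)) / M = -(1 / M) := by ring
    rw [e1, Real.exp_neg] at hlo
    rw [div_le_div_iff₀ (by positivity) (by positivity)]
    have hE0 : 0 < Real.exp (1 / M) := Real.exp_pos _
    have h' := mul_le_mul_of_nonneg_left hlo (by positivity : (0 : ℝ) ≤ 2 * T' * Real.exp (1 / M))
    have e2 : 2 * T' * Real.exp (1 / M) * (horizonSlope M a / 2 * (sN * (Real.exp (1 / M))⁻¹)) =
        T' * horizonSlope M a * sN := by field_simp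
    calc 1 * (T' * horizonSlope M a * sN) = T' * horizonSlope M a * sN := one_mul _
      _ = 2 * T' * Real.exp (1 / M) * (horizonSlope M a / 2 * (sN * (Real.exp (1 / M))⁻¹)) := e2.symm
      _ ≤ 2 * T' * Real.exp (1 / M) * nearPotentialTilde M a ω m Λ R x₁ T' := h'
      _ = 2 * Real.exp (1 / M) * (T' * nearPotentialTilde M a ω m Λ R x₁ T') := by ring
  have h3 : 8 * horizonDerivBound M a Λ₁ * sN *
      (U + 1 + 2 * Real.exp (1 / M) / (T' * horizonSlope M a * sN)) / c₁ ^ 2 ≤ t :=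
    (le_max_right _ _).trans ht
  have h4 : U + 1 + 2 * Real.exp (1 / M) / (T' * horizonSlope M a * sN) ≤
      c₁ ^ 2 * t / (8 * horizonDerivBound M a Λ₁ * sN) := by
    rw [div_le_iff₀ (by positivity)] at h3
    rw [le_div_iff₀ (by positivity)]
    nlinarith
  unfold lowFreqF
  linarith

/-- At the far end: `y = σY_F(∞)`, `h = 0`, `χ₂ = 1`, `χ₁ = 0` for
`r* ≥ x₀ + max(2Te^{1/p}, T_s)`. [folklore] -/
theorem lowFreq_far_end {P : LowFreqParams} (hP : P.ValidM M a ω m Λ R) {Ts : ℝ} (hTs : P.T ≤ Ts)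
    (hsat : ∀ t, Ts ≤ t → P.U₁ + 1 ≤ lowFreqF (farPotentialM M a ω m Λ R P.x₀) P.T t) {x : ℝ}
    (hx : P.x₀ + max (2 * P.T * Real.exp (1 / P.p)) Ts ≤ x) :
    (lowFreqMultipliers M a ω m Λ R P).y x = P.σ * lowFreqTop P.ε P.u₀ P.U₁ ∧
      (lowFreqMultipliers M a ω m Λ R P).h x = 0 ∧ (lowFreqMultipliers M a ω m Λ R P).χ₂ x = 1 ∧
      (lowFreqMultipliers M a ω m Λ R P).χ₁ x = 0 := by
  have hT : 0 < 2 * P.T := by linarith [hP.T_gt]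
  have hexp : 1 ≤ Real.exp (1 / P.p) := Real.one_le_exp (one_div_pos.2 hP.p_pos).le
  have h1 : 2 * P.T * Real.exp (1 / P.p) ≤ x - P.x₀ := by
    have := le_max_left (2 * P.T * Real.exp (1 / P.p)) Ts; linarith
  have h2 : Ts ≤ x - P.x₀ := by have := le_max_right (2 * P.T * Real.exp (1 / P.p)) Ts; linarith
  have hxb : P.xb ≤ x := by unfold LowFreqParams.xb; nlinarith [hP.T_gt]
  have hxN : P.xN ≤ x := by linarith [hP.xN_lt_xb]
  obtain ⟨e1, -, -, e4, -⟩ := lowFreq_eq_far hP hxN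
  obtain ⟨⟨-, c1, -, -⟩, -, -, c2⟩ := lowFreq_cutoffs (M := M) (a := a) (ω := ω) (m := m) (Λ := Λ)
    (R := R) hP x
  rw [e1, e4, lowFreqCutoff_eq_zero hT hP.p_pos h1,
    lowFreqWeight_eq_top hP.u₀_pos hP.U₁_ge (hTs.trans h2) (hsat _ h2), c1, c2 hxb]
  simp

end Saturation

/-! ### Proposition 8.7.1 -/

section Choice

variable {M a : ℝ} {R : ℝ → ℝ}

open LowFreq in
set_option maxHeartbeats 4000000 in
/-- **Proposition 8.7.1 of DRSR arXiv:1402.7034 (the low-frequency subrange of `𝓖_♭` for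
`0 ≤ a < ã₀`), explicit and `a`-uniform form.** Let `0 < M`, `R` a tortoise radius function of
`g_{M,a}`, `Λ₁ ≥ 0` (the bound `ε_width⁻¹ω_high²` for `Λ` in `𝓖_♭`), `δ₀ > 0` and `R_b` the ends of
the region of integration, `E ≥ 2`, `D₁, D₂` bounds for `|φ'|, |φ''|`, and let `a` satisfy the
smallness conditions `LowFreq.SmallA M a Λ₁ δ₀ R_b E D₁ D₂` (all `a`-free). Then there is `X`
("`R*_∞`") such that for every admissible `(ω, m, Λ)` with `Λ ≤ Λ₁` and `|ω| ≤ ω₀`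
(`ω₀ = LowFreq.ω₀ M Λ₁ δ₀ R_b D₁ D₂`, "`ω_low`", `a`-free) there are multipliers `h, y, χ₁, χ₂`
(`lowFreqMultipliers M a ω m Λ R P`, `f = 0`), differentiable, with `0 ≤ h ≤ 2`, `|y| ≤ 1`,
`0 ≤ χ₂ ≤ 1`, `χ₁ = 1 − χ₂`, with `y = 1, h = 0, χ₂ = 1, χ₁ = 0` for `r* ≥ X`, such that for all
solutions `u` of `u'' + (ω² − V)u = H` (`H` continuous, `Re(u'H̄)`, `Im(Hū)` integrable) with
`u' − iωu → 0`, `|u|² → A_∞` at `+∞` and `u' + i(ω − ω₊m)u → 0`, `|u|² → A_H` at `−∞`: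
`b ∫_{x₁}^{x₂} (|u'|² + |u|²) ≤ ∫ (−h Re(uH̄) − 2y Re(u'H̄) + E(χ₂ω + χ₁(ω − ω₊m)) Im(Hū))`
with the `a`-free constant `b = LowFreq.b M Λ₁ δ₀ R_b D₁ D₂ > 0`, whenever `r₊ + δ₀ ≤ R(x₁)`,
`R(x₂) ≤ R_b`. [cite: DafermosRodnianskiShlapentokhrothman2014, Prop. 8.7.1] -/
theorem lowFreq_estimate (hM : 0 < M) (hR : IsTortoiseRadius M a R) {Λ₁ δ₀ E D₁ D₂ : ℝ} (Rb : ℝ)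
    (hΛ₁ : 0 ≤ Λ₁) (hδ₀ : 0 < δ₀) (hE : 2 ≤ E) (hD₁ : ∀ s, |sharpBump₁ s| ≤ D₁)
    (hD₂ : ∀ s, |sharpBump₂ s| ≤ D₂) (hA : SmallA M a Λ₁ δ₀ Rb E D₁ D₂) :
    0 < LowFreq.b M Λ₁ δ₀ Rb D₁ D₂ ∧ 0 < LowFreq.ω₀ M Λ₁ δ₀ Rb D₁ D₂ ∧
    ∃ X : ℝ, ∀ (ω : ℝ) (m : ℤ) (Λ : ℝ), IsAdmissibleTriple a ω m Λ → Λ ≤ Λ₁ →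
      |ω| ≤ LowFreq.ω₀ M Λ₁ δ₀ Rb D₁ D₂ →
      ∃ P : LowFreqParams, 0 < P.σ ∧ (lowFreqMultipliers M a ω m Λ R P).HasDerivs ∧
        (∀ x, (0 ≤ (lowFreqMultipliers M a ω m Λ R P).h x ∧ (lowFreqMultipliers M a ω m Λ R P).h x ≤ 2) ∧
          |(lowFreqMultipliers M a ω m Λ R P).y x| ≤ 1 ∧
          (lowFreqMultipliers M a ω m Λ R P).χ₂ x ∈ Icc (0 : ℝ) 1 ∧
          (lowFreqMultipliers M a ω m Λ R P).χ₁ x = 1 - (lowFreqMultipliers M a ω m Λ R P).χ₂ x) ∧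
        (∀ x, X ≤ x → (lowFreqMultipliers M a ω m Λ R P).y x = 1 ∧
          (lowFreqMultipliers M a ω m Λ R P).h x = 0 ∧ (lowFreqMultipliers M a ω m Λ R P).χ₂ x = 1 ∧
          (lowFreqMultipliers M a ω m Λ R P).χ₁ x = 0) ∧
        ∀ (u u₁ u₂ H : ℝ → ℂ) (Atop Abot x₁ x₂ : ℝ), x₁ ≤ x₂ → rPlus M a + δ₀ ≤ R x₁ → R x₂ ≤ Rb →
          (∀ x, HasDerivAt u (u₁ x) x) → (∀ x, HasDerivAt u₁ (u₂ x) x) →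
          (∀ x, u₂ x + ((ω ^ 2 - sepPotential M a ω m Λ (R x) : ℝ) : ℂ) * u x = H x) →
          Continuous H → Integrable (fun x ↦ ⟪H x, u₁ x⟫_ℝ) →
          Integrable (fun x ↦ (H x * conj (u x)).im) →
          Tendsto (fun x ↦ u₁ x - Complex.I * ω * u x) atTop (𝓝 0) →
          Tendsto (fun x ↦ u₁ x +
            Complex.I * ((ω - horizonAngularVelocity M a * m : ℝ) : ℂ) * u x) atBot (𝓝 0) →
          Tendsto (fun x ↦ ‖u x‖ ^ 2) atTop (𝓝 Atop) → Tendsto (fun x ↦ ‖u x‖ ^ 2) atBot (𝓝 Abot) →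
          LowFreq.b M Λ₁ δ₀ Rb D₁ D₂ * ∫ x in x₁..x₂, (‖u₁ x‖ ^ 2 + ‖u x‖ ^ 2) ≤
            ∫ x, combinedSource ω (ω - horizonAngularVelocity M a * m) E
              (lowFreqMultipliers M a ω m Λ R P) u u₁ H x := by
  have ha0 := hA.nonneg
  have ha2 := hA.half
  have hMa : IsSubextremal M a := by unfold IsSubextremal; rw [abs_of_nonneg ha0]; linarith
  have haM : |a| ≤ M := le_of_lt hMa
  have hrpM : M ≤ rPlus M a := M_le_rPlus M a
  have hrp0 : 0 < rPlus M a := hM.trans_le hrpM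
  have hrp1 := rPlus_ge_smallA hM.le ha0 ha2
  have hrp2 : rPlus M a ≤ 2 * M := rPlus_le_two_mul_smallA hM.le a
  have hsqrt := sqrt_ge_smallA hM.le ha0 ha2
  have hpm := rPlus_sub_rMinus_ge_smallA hM.le ha0 ha2
  have hra := rPlus_sq_sub_sq_ge_smallA hM.le ha0 ha2
  have hD₁0 : 0 ≤ D₁ := (abs_nonneg _).trans (hD₁ 0)
  have hD₂0 : 0 ≤ D₂ := (abs_nonneg _).trans (hD₂ 0)
  -- κ_H, L, κ₂ versus their uniform bounds
  have hκ := horizonSlope_pos hMa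
  have hκu0 : 0 < κu M := by unfold κu; positivity
  have hκuκ : κu M ≤ horizonSlope M a := horizonSlope_ge_smallA hM ha0 ha2
  have hLu0 : 0 ≤ Lu M Λ₁ := by unfold Lu; positivity
  have hLLu : horizonCurv M a Λ₁ ≤ Lu M Λ₁ := horizonCurv_le hM hΛ₁
  have hκ₂u0 : 0 < κ₂u M Λ₁ := by unfold κ₂u; positivity
  have hκ₂κ₂u : horizonDerivBound M a Λ₁ ≤ κ₂u M Λ₁ := by
    unfold horizonDerivBound κ₂u
    have h1 : 24 * Λ₁ / rPlus M a ^ 3 ≤ 24 * Λ₁ / M ^ 3 := by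
      apply div_le_div_of_nonneg_left (by positivity) (by positivity); gcongr
    have h2 : 184 * M / rPlus M a ^ 4 ≤ 184 / M ^ 3 := by
      rw [div_le_div_iff₀ (by positivity) (by positivity)]
      have h3 : M ^ 4 ≤ rPlus M a ^ 4 := by gcongr
      have h4 := mul_le_mul_of_nonneg_left h3 (by norm_num : (0 : ℝ) ≤ 184)
      calc 184 * M * M ^ 3 = 184 * M ^ 4 := by ring
        _ ≤ 184 * rPlus M a ^ 4 := h4
    linarith only [h1, h2]
  -- the near margin
  obtain ⟨s, hs⟩ : ∃ s, s = sN M Λ₁ δ₀ := ⟨_, rfl⟩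
  have hs0 : 0 < s := by rw [hs]; unfold sN; exact lt_min hδ₀ (lt_min (by positivity) hM)
  have hsδ : s ≤ δ₀ := by rw [hs]; exact min_le_left _ _
  have hsM : s ≤ M := by rw [hs]; exact (min_le_right _ _).trans (min_le_right _ _)
  have hsr : s ≤ rPlus M a := hsM.trans hrpM
  have hsL : s * horizonCurv M a Λ₁ ≤ horizonSlope M a / 2 := by
    have h1 : s ≤ κu M / (2 * (Lu M Λ₁ + 1)) := by
      rw [hs]; exact (min_le_right _ _).trans (min_le_left _ _)
    rw [le_div_iff₀ (by positivity)] at h1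
    have h2 : s * horizonCurv M a Λ₁ ≤ s * (Lu M Λ₁ + 1) :=
      mul_le_mul_of_nonneg_left (by linarith only [hLLu]) hs0.le
    linarith only [h1, h2, hκuκ]
  obtain ⟨xN, hxN⟩ := hR.exists_eq hMa (show rPlus M a < rPlus M a + s by linarith)
  -- the far radius
  obtain ⟨Rb', hRb'⟩ : ∃ Rb'', Rb'' = Rb' M Rb := ⟨_, rfl⟩
  have hRb20 : 20 * M ≤ Rb' := by rw [hRb']; exact le_max_right _ _
  have hRbRb : Rb ≤ Rb' := by rw [hRb']; exact le_max_left _ _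
  have hRb0 : 0 < Rb' := by linarith
  obtain ⟨xb, hxb⟩ := hR.exists_eq hMa (show rPlus M a < Rb' by linarith)
  have hxNb : xN < xb := by
    rw [← (hR.strictMono hMa).lt_iff_lt, hxN, hxb]; linarith
  have hℓ : ℓu M Rb ≤ xb - xN := by
    have h := hR.sub_le hMa hxNb.le
    rw [hxN, hxb] at h
    unfold ℓu; rw [← hRb']; linarith
  have hℓu0 : 0 < ℓu M Rb := by unfold ℓu; rw [← hRb']; linarith
  obtain ⟨x₀, hx₀⟩ : ∃ x₀, x₀ = xb - Rb' := ⟨_, rfl⟩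
  obtain ⟨T, hT⟩ : ∃ T', T' = LowFreq.T M Rb := ⟨_, rfl⟩
  have hTdef : T = Rb' + 1 := by rw [hT, hRb']; rfl
  have hT1 : 1 < T := by rw [hTdef]; linarith
  have hT0 : 0 < T := by linarith
  -- the near origin
  obtain ⟨T', hT'⟩ : ∃ T'', T'' = LowFreq.T' M Λ₁ := ⟨_, rfl⟩
  have hT'ge : nearThreshold M a Λ₁ + 2 ≤ T' := by
    rw [hT']
    unfold LowFreq.T' nearThreshold
    have hnum : 12 * horizonDerivBound M a Λ₁ * rPlus M a ^ 2 ≤ 12 * κ₂u M Λ₁ * (2 * M) ^ 2 := by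
      have h1 : rPlus M a ^ 2 ≤ (2 * M) ^ 2 := pow_le_pow_left₀ hrp0.le hrp2 2
      have h0 := (horizonDerivBound_nonneg hMa hΛ₁).1
      exact mul_le_mul (mul_le_mul_of_nonneg_left hκ₂κ₂u (by norm_num)) h1 (sq_nonneg _)
        (by positivity)
    have hden : 43 / 50 * M * κu M ≤ √(M ^ 2 - a ^ 2) * horizonSlope M a :=
      mul_le_mul hsqrt hκuκ hκu0.le (Real.sqrt_nonneg _)
    have hden0 : 0 < 43 / 50 * M * κu M := by positivity
    have := div_le_div₀ (by positivity) hnum hden0 hden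
    linarith only [this]
  have hT'1 : 1 < T' := by linarith [(horizonDerivBound_nonneg hMa hΛ₁).2]
  have hT'0 : 0 < T' := by linarith
  obtain ⟨x₁, hx₁⟩ : ∃ x₁, x₁ = xN + T' - 1 := ⟨_, rfl⟩
  -- far gain and rate
  obtain ⟨ε, hε⟩ : ∃ ε', ε' = LowFreq.ε M Rb := ⟨_, rfl⟩
  have hεdef : ε = M / (10 * T ^ 2) := by rw [hε, hT]; rfl
  have hε0 : 0 < ε := by rw [hεdef]; positivity
  obtain ⟨p, hp⟩ : ∃ p', p' = LowFreq.p M Rb D₁ D₂ := ⟨_, rfl⟩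
  have hpdef : p = min 1 (2 * ε / (D₁ + D₂ + 1)) := by rw [hp, hε]; rfl
  have hp0 : 0 < p := by rw [hpdef]; exact lt_min one_pos (by positivity)
  have hp1 : p ≤ 1 := by rw [hpdef]; exact min_le_left _ _
  have hpε : p * (D₁ + D₂) ≤ 2 * ε := by
    have h1 : p ≤ 2 * ε / (D₁ + D₂ + 1) := by rw [hpdef]; exact min_le_right _ _
    rw [le_div_iff₀ (by positivity)] at h1
    have h2 : p * (D₁ + D₂) ≤ p * (D₁ + D₂ + 1) := mul_le_mul_of_nonneg_left (by linarith) hp0.le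
    linarith only [h1, h2]
  obtain ⟨Te, hTe⟩ : ∃ Te', Te' = LowFreq.Te M Rb D₁ D₂ := ⟨_, rfl⟩
  have hTedef : Te = 2 * T * Real.exp (1 / p) := by rw [hTe, hT, hp]; rfl
  have hexp1 : 1 ≤ Real.exp (1 / p) := Real.one_le_exp (one_div_pos.2 hp0).le
  have hTe2 : 2 * T ≤ Te := by rw [hTedef]; exact le_mul_of_one_le_right (by linarith) hexp1
  have hTeT : T - 1 ≤ Te := by linarith only [hTe2, hT0]
  have hTe0 : 0 < Te := by linarith
  -- near gain and rate
  obtain ⟨ε', hε'⟩ : ∃ e, e = LowFreq.ε' M Λ₁ δ₀ := ⟨_, rfl⟩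
  have hε'def : ε' = T' * κu M * s * Real.exp (-(1 / M)) / 10 := by rw [hε', hT', hs]; rfl
  have hε'0 : 0 < ε' := by rw [hε'def]; positivity
  obtain ⟨p', hp'⟩ : ∃ q, q = LowFreq.p' M Λ₁ δ₀ D₁ D₂ := ⟨_, rfl⟩
  have hp'def : p' = min 1 (2 * ε' / (D₁ + D₂ + 1)) := by rw [hp', hε']; rfl
  have hp'0 : 0 < p' := by rw [hp'def]; exact lt_min one_pos (by positivity)
  have hp'1 : p' ≤ 1 := by rw [hp'def]; exact min_le_left _ _
  have hpε' : p' * (D₁ + D₂) ≤ 2 * ε' := by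
    have h1 : p' ≤ 2 * ε' / (D₁ + D₂ + 1) := by rw [hp'def]; exact min_le_right _ _
    rw [le_div_iff₀ (by positivity)] at h1
    have h2 : p' * (D₁ + D₂) ≤ p' * (D₁ + D₂ + 1) := mul_le_mul_of_nonneg_left (by linarith) hp'0.le
    linarith only [h1, h2]
  obtain ⟨Te', hTe'⟩ : ∃ e, e = LowFreq.Te' M Λ₁ δ₀ D₁ D₂ := ⟨_, rfl⟩
  have hTe'def : Te' = 2 * T' * Real.exp (1 / p') := by rw [hTe', hT', hp']; rfl
  have hexp1' : 1 ≤ Real.exp (1 / p') := Real.one_le_exp (one_div_pos.2 hp'0).le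
  have hTe'2 : 2 * T' ≤ Te' := by rw [hTe'def]; exact le_mul_of_one_le_right (by linarith) hexp1'
  have hTe'T : T' - 1 ≤ Te' := by linarith only [hTe'2, hT'0]
  have hTe'0 : 0 < Te' := by linarith
  -- frequency thresholds
  obtain ⟨ω₁, hω₁⟩ : ∃ w, w = LowFreq.ω₁ M Rb D₁ D₂ := ⟨_, rfl⟩
  have hω₁def : ω₁ = M / (2 * Te ^ 3) := by rw [hω₁, hTe]; rfl
  have hω₁0 : 0 < ω₁ := by rw [hω₁def]; positivity
  obtain ⟨ω₂, hω₂⟩ : ∃ w, w = LowFreq.ω₂ M Λ₁ δ₀ D₁ D₂ := ⟨_, rfl⟩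
  have hω₂def : ω₂ = κu M / 2 * (s * Real.exp (-(Te' - (T' - 1)) / M)) := by
    rw [hω₂, hs, hTe', hT']; rfl
  have hω₂0 : 0 < ω₂ := by rw [hω₂def]; positivity
  obtain ⟨v, hv⟩ : ∃ w, w = LowFreq.v M Λ₁ δ₀ Rb := ⟨_, rfl⟩
  have hvdef : v = min (s * (43 / 25 * M) * (2 * M * (93 / 50 * M) * (3 * M ^ 2)) / (17 * M ^ 2) ^ 4)
      (M / (2 * Rb' ^ 3)) := by rw [hv, hs, hRb']; rfl
  have hv0 : 0 < v := by rw [hvdef]; exact lt_min (by positivity) (by positivity)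
  obtain ⟨ω₀, hω₀⟩ : ∃ w, w = LowFreq.ω₀ M Λ₁ δ₀ Rb D₁ D₂ := ⟨_, rfl⟩
  have hω₀sq : ω₀ ^ 2 = min (v / 2) (min ω₁ (ω₂ / 4)) := by
    rw [hω₀]; unfold LowFreq.ω₀ LowFreq.ω₀sq
    rw [← hv, ← hω₁, ← hω₂, Real.sq_sqrt]
    exact le_min (by linarith) (le_min hω₁0.le (by linarith))
  have hmin0 : 0 < min (v / 2) (min ω₁ (ω₂ / 4)) := lt_min (by linarith) (lt_min hω₁0 (by linarith))
  have hω₀nn : 0 ≤ ω₀ := by rw [hω₀]; exact Real.sqrt_nonneg _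
  have hω₀0 : 0 < ω₀ := by
    refine lt_of_le_of_ne hω₀nn fun h ↦ ?_
    rw [← h] at hω₀sq
    norm_num at hω₀sq
    linarith [hmin0, hω₀sq.symm.le, hω₀sq.le]
  -- the smallness conditions, in terms of the local names
  have hfarω : 20 * (a * ω₀) ≤ 1 := by rw [hω₀]; exact hA.farω
  have hmid₁ : 2 * a ^ 2 ≤ M * s := by rw [hs]; exact hA.mid₁
  have hmid₂ : 8 * M * a * ω₀ ≤ s := by rw [hs, hω₀]; exact hA.mid₂
  have hnearϖ : a ^ 2 * Λ₁ ≤ M ^ 4 * ω₂ := by rw [hω₂]; exact hA.nearϖ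
  -- uniform bounds for the saturation levels
  obtain ⟨BN, hBN⟩ : ∃ e, e = LowFreq.BN M Λ₁ δ₀ D₁ D₂ := ⟨_, rfl⟩
  have hBNdef : BN = 1 / 2 + ε' * (1 / (Te' * ω₂) + 1 / 2) := by rw [hBN, hε', hTe', hω₂]; rfl
  have hBN0 : 0 < BN := by rw [hBNdef]; positivity
  obtain ⟨U₁max, hU₁max⟩ : ∃ e, e = LowFreq.U₁max M Λ₁ δ₀ Rb D₁ D₂ := ⟨_, rfl⟩
  have hU₁maxdef : U₁max = max (1 / (Te * ω₁)) (BN / ε) := by rw [hU₁max, hTe, hω₁, hBN, hε]; rfl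
  have hU₁max0 : 0 ≤ U₁max := by rw [hU₁maxdef]; exact le_max_of_le_left (by positivity)
  obtain ⟨BF, hBF⟩ : ∃ e, e = LowFreq.BF M Λ₁ δ₀ Rb D₁ D₂ := ⟨_, rfl⟩
  have hBFdef : BF = 1 / 2 + ε * (U₁max + 1 / 2) := by rw [hBF, hε, hU₁max]; rfl
  have hBF0 : 0 < BF := by rw [hBFdef]; positivity
  obtain ⟨b, hb⟩ : ∃ e, e = LowFreq.b M Λ₁ δ₀ Rb D₁ D₂ := ⟨_, rfl⟩
  have hbdef : b = min 1 (v / 2) / (2 * BF) := by rw [hb, hv, hBF]; rfl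
  have hb0 : 0 < b := by rw [hbdef]; exact div_pos (lt_min one_pos (by linarith)) (by positivity)
  have hcutA : E * a * √Λ₁ * BF ≤ M ^ 2 * ℓu M Rb * min 1 (v / 2) := by rw [hBF, hv]; exact hA.cut
  obtain ⟨Ts, hTs⟩ : ∃ Ts, Ts = max T (12 * (Λ₁ + 1) * (U₁max + 1 + 2 * T ^ 2 / M)) := ⟨_, rfl⟩
  have hTsT : T ≤ Ts := by rw [hTs]; exact le_max_left _ _
  obtain ⟨X, hX⟩ : ∃ X, X = x₀ + max Te Ts := ⟨_, rfl⟩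
  refine ⟨by rwa [← hb], by rwa [← hω₀], X, fun ω m Λ hadm hΛ hω ↦ ?_⟩
  rw [← hω₀] at hω
  -- now fix the triple
  have hΛ0 := hadm.nonneg
  have hω2 : ω ^ 2 ≤ min (v / 2) (min ω₁ (ω₂ / 4)) := by
    rw [← hω₀sq, ← sq_abs ω]; exact pow_le_pow_left₀ (abs_nonneg ω) hω 2
  have hωv : ω ^ 2 ≤ v / 2 := hω2.trans (min_le_left _ _)
  have hωω₁ : ω ^ 2 ≤ ω₁ := hω2.trans ((min_le_right _ _).trans (min_le_left _ _))
  have hωω₂ : ω ^ 2 ≤ ω₂ / 4 := hω2.trans ((min_le_right _ _).trans (min_le_right _ _))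
  -- the horizon frequency ϖ = ω − ω₊ m
  set ϖ := ω - horizonAngularVelocity M a * m with hϖ
  have hΩ0 := horizonAngularVelocity_nonneg hM.le ha0
  have hΩ : horizonAngularVelocity M a ≤ a / (2 * M ^ 2) := by
    unfold horizonAngularVelocity
    apply div_le_div_of_nonneg_left ha0 (by positivity)
    calc 2 * M ^ 2 = 2 * M * M := by ring
      _ ≤ 2 * M * rPlus M a := by gcongr
  have hmΛ : |(m : ℝ)| ≤ √Λ₁ := hadm.abs_le_sqrt.trans (Real.sqrt_le_sqrt hΛ)
  have hωϖ : |ω - ϖ| ≤ a / (2 * M ^ 2) * √Λ₁ := by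
    have : ω - ϖ = horizonAngularVelocity M a * m := by rw [hϖ]; ring
    rw [this, abs_mul, abs_of_nonneg hΩ0]
    exact mul_le_mul hΩ hmΛ (abs_nonneg _) (by positivity)
  have hϖ2 : ϖ ^ 2 ≤ ω₂ := by
    have h1 : ϖ ^ 2 ≤ 2 * ω ^ 2 + 2 * (ω - ϖ) ^ 2 := by
      nlinarith only [sq_nonneg (2 * ω - ϖ)]
    have h2 : (ω - ϖ) ^ 2 ≤ (a / (2 * M ^ 2) * √Λ₁) ^ 2 := by
      rw [← sq_abs (ω - ϖ)]; exact pow_le_pow_left₀ (abs_nonneg _) hωϖ 2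
    have h3 : (a / (2 * M ^ 2) * √Λ₁) ^ 2 = a ^ 2 * Λ₁ / (4 * M ^ 4) := by
      rw [mul_pow, Real.sq_sqrt hΛ₁]; field_simp; ring
    have h4 : a ^ 2 * Λ₁ / (4 * M ^ 4) ≤ ω₂ / 4 := by
      rw [div_le_div_iff₀ (by positivity) (by norm_num)]; linarith only [hnearϖ]
    linarith only [h1, h2, h3, h4, hωω₂]
  have hϖeq : ω ^ 2 - sepPotential M a ω m Λ (rPlus M a) = ϖ ^ 2 := by
    rw [omega_sq_sub_sepPotential_rPlus haM hM ω m Λ, hϖ]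
    unfold horizonAngularVelocity
    field_simp
    ring
  -- far and near data
  have hfar := fun t (ht : T - 1 ≤ t) ↦
    far_data_smallA (m := m) hM ha0 ha2 hR hRb20 hxb hx₀ hTdef hadm hω hfarω ht
  have hnear := fun t (ht : T' - 1 ≤ t) ↦
    near_data_smallA hM ha0 ha2 hR hadm hΛ hω hfarω hs0 hsL hsr hxN hT'ge hx₁ ht
  set WF := farPotentialM M a ω m Λ R x₀ with hWF
  set WN := nearPotentialTilde M a ω m Λ R x₁ with hWN
  have hWFT : M / (2 * T ^ 3) ≤ WF T := (hfar T (by linarith)).2.2.2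
  have hWFT0 : 0 < WF T := (hfar T (by linarith)).2.1
  have hWNT0 : 0 < WN T' := (hnear T' (by linarith)).2.1
  have hWNTlo : κu M / 2 * (s * Real.exp (-(1 / M))) ≤ WN T' := by
    obtain ⟨-, -, -, ⟨hlo, -⟩, ⟨hRlo, -⟩⟩ := hnear T' (by linarith)
    have e1 : -(T' - (T' - 1)) / M = -(1 / M) := by ring
    rw [e1] at hRlo
    have h1 : κu M / 2 * (s * Real.exp (-(1 / M))) ≤ horizonSlope M a / 2 * (s * Real.exp (-(1 / M))) :=
      mul_le_mul_of_nonneg_right (by linarith) (by positivity)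
    exact h1.trans (le_trans (mul_le_mul_of_nonneg_left hRlo (by positivity)) hlo)
  -- per-triple levels
  obtain ⟨u₀, hu₀⟩ : ∃ u₀, u₀ = 1 / 2 / (4 * T * WF T) := ⟨_, rfl⟩
  have hu₀0 : 0 < u₀ := by rw [hu₀]; positivity
  obtain ⟨u₀', hu₀'⟩ : ∃ u₀', u₀' = 1 / 2 / (4 * T' * WN T') := ⟨_, rfl⟩
  have hu₀'0 : 0 < u₀' := by rw [hu₀']; positivity
  obtain ⟨U₁', hU₁'⟩ : ∃ U₁', U₁' = lowFreqF WN T' Te' := ⟨_, rfl⟩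
  obtain ⟨U₁, hU₁⟩ : ∃ U₁, U₁ = max (lowFreqF WF T Te) (BN / ε) := ⟨_, rfl⟩
  -- the hypotheses of the one-sided lemmas
  have hWFd : ∀ t, T - 1 ≤ t → HasDerivAt WF (farPotentialMDeriv M a ω m Λ R x₀ t) t :=
    fun t _ ↦ hasDerivAt_farPotentialM hR hMa x₀ t
  have hWFpos : ∀ t, T - 1 ≤ t → 0 < WF t := fun t ht ↦ (hfar t ht).2.1
  have hWFdec : ∀ t, T - 1 ≤ t → (1 + 1 / 2) * WF t ≤ -(t * farPotentialMDeriv M a ω m Λ R x₀ t) :=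
    fun t ht ↦ (hfar t ht).2.2.1
  have hWNd : ∀ t, T' - 1 ≤ t → HasDerivAt WN (nearPotentialTildeDeriv M a ω m Λ R x₁ t) t :=
    fun t _ ↦ hasDerivAt_nearPotentialTilde hR hMa x₁ t
  have hWNpos : ∀ t, T' - 1 ≤ t → 0 < WN t := fun t ht ↦ (hnear t ht).2.1
  have hWNdec : ∀ t, T' - 1 ≤ t →
      (1 + 1 / 2) * WN t ≤ -(t * nearPotentialTildeDeriv M a ω m Λ R x₁ t) :=
    fun t ht ↦ (hnear t ht).2.2.1
  have hc : (0 : ℝ) ≤ 1 / 2 := by norm_num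
  have hmonoF := lowFreqF_monotoneOn hT1 hc hWFd hWFpos hWFdec
  have hmonoN := lowFreqF_monotoneOn hT'1 hc hWNd hWNpos hWNdec
  have hu₀F : u₀ ≤ lowFreqF WF T (2 * T) := lowFreq_u₀_le hT1 hc hWFd hWFpos hWFdec hu₀
  have hu₀N : u₀' ≤ lowFreqF WN T' (2 * T') := lowFreq_u₀_le hT'1 hc hWNd hWNpos hWNdec hu₀'
  have hU₁ge : lowFreqF WF T Te ≤ U₁ := by rw [hU₁]; exact le_max_left _ _
  have hu₀U₁ : u₀ ≤ U₁ := hu₀F.trans ((hmonoF (by simp only [mem_Ici]; linarith)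
    (by simp only [mem_Ici]; linarith) hTe2).trans hU₁ge)
  have hu₀U₁' : u₀' ≤ U₁' := hu₀N.trans (le_of_le_of_eq (hmonoN (by simp only [mem_Ici]; linarith)
    (by simp only [mem_Ici]; linarith) hTe'2) hU₁'.symm)
  -- ω below W at Te, ϖ below W̃ at Te'
  have hωF : ω ^ 2 ≤ WF Te := by
    refine hωω₁.trans (le_trans ?_ (hfar Te hTeT).2.2.2)
    rw [hω₁def]
  have hWNTe : ω₂ ≤ WN Te' := by
    obtain ⟨-, -, -, ⟨hlo, -⟩, ⟨hRlo, -⟩⟩ := hnear Te' hTe'T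
    rw [hω₂def]
    have h1 : κu M / 2 * (s * Real.exp (-(Te' - (T' - 1)) / M)) ≤
        horizonSlope M a / 2 * (s * Real.exp (-(Te' - (T' - 1)) / M)) :=
      mul_le_mul_of_nonneg_right (by linarith) (by positivity)
    exact h1.trans (le_trans (mul_le_mul_of_nonneg_left hRlo (by positivity)) hlo)
  have hϖN : ϖ ^ 2 ≤ WN Te' := hϖ2.trans hWNTe
  -- gains
  have hεK : 5 * ε ≤ T * WF T := by
    rw [hεdef]
    have := mul_le_mul_of_nonneg_left hWFT hT0.le
    have e : T * (M / (2 * T ^ 3)) = 5 * (M / (10 * T ^ 2)) := by field_simp; ring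
    linarith
  have hεK' : 5 * ε' ≤ T' * WN T' := by
    rw [hε'def]
    have e : 5 * (T' * κu M * s * Real.exp (-(1 / M)) / 10) =
        T' * (κu M / 2 * (s * Real.exp (-(1 / M)))) := by ring
    rw [e]
    exact mul_le_mul_of_nonneg_left hWNTlo hT'0.le
  -- tops
  have htopN : lowFreqTop ε' u₀' U₁' ≤ BN := by
    rw [hBNdef]
    unfold lowFreqTop
    have h1 : U₁' ≤ 1 / (Te' * ω₂) := by
      rw [hU₁']
      exact lowFreqF_le_of_ge (by linarith) hω₂0 hWNTe (mul_pos hT'0 hWNT0)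
    have h2 : U₁' - u₀' / 2 + 1 / 2 ≤ 1 / (Te' * ω₂) + 1 / 2 := by linarith only [h1, hu₀'0]
    have h3 := mul_le_mul_of_nonneg_left h2 hε'0.le
    linarith only [h3]
  have htopF : BN ≤ lowFreqTop ε u₀ U₁ := by
    unfold lowFreqTop
    have h1 : BN / ε ≤ U₁ := by rw [hU₁]; exact le_max_right _ _
    rw [div_le_iff₀ hε0] at h1
    have h2 : ε * u₀ ≤ 1 / 40 := by
      rw [hu₀]
      have e : ε * (1 / 2 / (4 * T * WF T)) = ε / (8 * (T * WF T)) := by field_simp; ring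
      rw [e, div_le_div_iff₀ (by positivity) (by norm_num)]
      linarith only [hεK]
    have e : 1 / 2 + ε * (U₁ - u₀ / 2 + 1 / 2) = (1 / 2 - ε * u₀ / 2 + ε / 2) + ε * U₁ := by ring
    rw [e]
    linarith only [h1, h2, hε0]
  have htop : lowFreqTop ε' u₀' U₁' ≤ lowFreqTop ε u₀ U₁ := htopN.trans htopF
  have htopF0 : 0 < lowFreqTop ε u₀ U₁ := hBN0.trans_le htopF
  have hU₁le : U₁ ≤ U₁max := by
    rw [hU₁, hU₁maxdef]
    refine max_le_max ?_ le_rfl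
    exact lowFreqF_le_of_ge hTe0 hω₁0 (by rw [hω₁def]; exact (hfar Te hTeT).2.2.2) (mul_pos hT0 hWFT0)
  have htopFle : lowFreqTop ε u₀ U₁ ≤ BF := by
    rw [hBFdef]
    unfold lowFreqTop
    have h2 : U₁ - u₀ / 2 + 1 / 2 ≤ U₁max + 1 / 2 := by linarith only [hU₁le, hu₀0]
    have h3 := mul_le_mul_of_nonneg_left h2 hε0.le
    linarith only [h3]
  have htopFge : 1 / 2 ≤ lowFreqTop ε u₀ U₁ := by
    unfold lowFreqTop
    have h1 : 0 ≤ U₁ - u₀ / 2 + 1 / 2 := by linarith only [hu₀U₁, hu₀0]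
    have h2 := mul_nonneg hε0.le h1
    linarith only [h2]
  obtain ⟨σ, hσ⟩ : ∃ σ, σ = 1 / lowFreqTop ε u₀ U₁ := ⟨_, rfl⟩
  have hσ0 : 0 < σ := by rw [hσ]; positivity
  have hσ2 : σ ≤ 2 := by rw [hσ, div_le_iff₀ htopF0]; linarith only [htopFge]
  have hσBF : 1 / BF ≤ σ := by rw [hσ]; exact one_div_le_one_div_of_le htopF0 htopFle
  have hnorm : σ * lowFreqTop ε u₀ U₁ = 1 := by rw [hσ]; field_simp
  -- the parameter record
  set P : LowFreqParams := ⟨σ, x₀, T, ε, p, u₀, U₁, x₁, T', ε', p', u₀', U₁'⟩ with hPdef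
  have hPxN : P.xN = xN := by show x₁ - (T' - 1) = xN; rw [hx₁]; ring
  have hPxb : P.xb = xb := by show x₀ + (T - 1) = xb; rw [hx₀, hTdef]; ring
  have hPℓ : P.ℓ = xb - xN := by unfold LowFreqParams.ℓ; rw [hPxN, hPxb]
  have hPV : P.ValidM M a ω m Λ R :=
    ⟨hT1, hT'1, hp0, hp'0, hu₀0, hu₀'0, hu₀U₁, hu₀U₁', by rw [hPℓ]; linarith, hWFpos, hWFdec,
      hWNpos, hWNdec⟩
  have hPC : P.CoeffM M a ω ϖ m Λ R D₁ D₂ := by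
    refine ⟨hε0, hε'0, hp1, hp'1, hpε, hpε', hεK, hεK', hu₀, hu₀', ?_, ?_, ?_, ?_, hϖeq⟩
    · show lowFreqF WF T (2 * T * Real.exp (1 / p)) ≤ U₁
      rw [← hTedef]; exact hU₁ge
    · show lowFreqF WN T' (2 * T' * Real.exp (1 / p')) ≤ U₁'
      rw [← hTe'def, hU₁']
    · show ω ^ 2 ≤ WF (2 * T * Real.exp (1 / p))
      rw [← hTedef]; exact hωF
    · show ϖ ^ 2 ≤ WN (2 * T' * Real.exp (1 / p'))
      rw [← hTe'def]; exact hϖN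
  -- the middle lower bound
  have hVmid : ∀ x, P.xN ≤ x → x ≤ P.xb → v ≤ sepPotential M a ω m Λ (R x) := by
    intro x hx1 hx2
    rw [hPxN] at hx1
    rw [hPxb] at hx2
    have hmono := (hR.strictMono hMa).monotone
    have h1 : rPlus M a + s ≤ R x := by rw [← hxN]; exact hmono hx1
    have h2 : R x ≤ Rb' := by rw [← hxb]; exact hmono hx2
    have hV₁ : sepPotential₁ M a (R x) ≤ sepPotential M a ω m Λ (R x) :=
      sepPotential₁_le_sepPotential_smallA hM ha0 ha2 hadm hω hmid₁ hmid₂ h1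
    refine le_trans ?_ hV₁
    rw [hvdef]
    rcases le_or_gt (R x) (4 * M) with h4 | h4
    · refine (min_le_left _ _).trans (le_trans ?_ (sepPotential₁_ge_near hMa hs0 h1 h4))
      apply div_le_div_of_nonneg_right _ (by positivity)
      have t1 : 2 * M * (93 / 50 * M) ≤ 2 * M * rPlus M a := mul_le_mul_of_nonneg_left hrp1 (by positivity)
      have t2 : 2 * M * (93 / 50 * M) * (3 * M ^ 2) ≤ 2 * M * rPlus M a * (rPlus M a ^ 2 - a ^ 2) :=
        mul_le_mul t1 hra (by positivity) (by positivity)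
      have t3 : s * (43 / 25 * M) ≤ s * (rPlus M a - rMinus M a) := mul_le_mul_of_nonneg_left hpm hs0.le
      exact mul_le_mul t3 t2 (by positivity) (mul_nonneg hs0.le (by linarith only [hpm, hM]))
    · refine (min_le_right _ _).trans (le_trans ?_ (sepPotential₁_ge_of_four_mul_le hM haM h4.le))
      have hR0 : 0 < R x := by linarith
      apply div_le_div_of_nonneg_left hM.le (by positivity)
      gcongr
  -- the cut-off error
  have hcut : 2 * (E * |ω - ϖ|) / P.ℓ ≤ P.σ * min 1 (v / 2) := by
    show 2 * (E * |ω - ϖ|) / P.ℓ ≤ σ * min 1 (v / 2)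
    rw [hPℓ]
    have hE0 : 0 ≤ E := by linarith
    have hℓ0 : 0 < xb - xN := by linarith
    have h1 : 2 * (E * |ω - ϖ|) / (xb - xN) ≤ 2 * (E * (a / (2 * M ^ 2) * √Λ₁)) / ℓu M Rb := by
      have t1 : 2 * (E * |ω - ϖ|) ≤ 2 * (E * (a / (2 * M ^ 2) * √Λ₁)) := by
        linarith only [mul_le_mul_of_nonneg_left hωϖ hE0]
      exact div_le_div₀ (by positivity) t1 hℓu0 hℓ
    have h2 : 2 * (E * (a / (2 * M ^ 2) * √Λ₁)) / ℓu M Rb = E * a * √Λ₁ / (M ^ 2 * ℓu M Rb) := by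
      field_simp
    have h3 : E * a * √Λ₁ / (M ^ 2 * ℓu M Rb) ≤ min 1 (v / 2) / BF := by
      rw [div_le_div_iff₀ (by positivity) hBF0]
      linarith only [hcutA]
    have h4 : min 1 (v / 2) / BF ≤ σ * min 1 (v / 2) := by
      rw [div_eq_mul_one_div, mul_comm]
      exact mul_le_mul_of_nonneg_right hσBF (le_min zero_le_one (by linarith))
    linarith only [h1, h2, h3, h4]
  -- saturation
  have hsat : ∀ t, Ts ≤ t → P.U₁ + 1 ≤ lowFreqF (farPotentialM M a ω m Λ R P.x₀) P.T t := by
    intro t ht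
    show U₁ + 1 ≤ lowFreqF WF T t
    have h2 := far_saturation_smallA (U := U₁max) hM ha0 ha2 hR hRb20 hxb hx₀ hTdef hadm hΛ hω hfarω
      (t := t) (by rw [← hTs]; exact ht)
    linarith
  obtain ⟨Ts', hTs'⟩ : ∃ Ts', Ts' = max (2 * T') (8 * horizonDerivBound M a Λ₁ * s *
      (U₁' + 1 + 2 * Real.exp (1 / M) / (T' * horizonSlope M a * s)) /
      (√(M ^ 2 - a ^ 2) / (4 * rPlus M a ^ 2)) ^ 2) := ⟨_, rfl⟩
  have hTs'T : P.T' ≤ Ts' := by show T' ≤ Ts'; rw [hTs']; exact le_max_of_le_left (by linarith)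
  have hsat' : ∀ t, Ts' ≤ t → P.U₁' + 1 ≤ lowFreqF (nearPotentialTilde M a ω m Λ R P.x₁) P.T' t := by
    intro t ht
    show U₁' + 1 ≤ lowFreqF WN T' t
    exact near_saturation_smallA (U := U₁') hM ha0 ha2 hR hadm hΛ hω hfarω hs0 hsL hsr hxN hT'ge hx₁
      (t := t) (by rw [← hTs']; exact ht)
  have hμ := hasDerivs_lowFreqMultipliers hMa hR hPV
  refine ⟨P, hσ0, hμ, fun x ↦ ?_, fun x hx ↦ ?_, ?_⟩
  · obtain ⟨⟨h1, h2⟩, h3⟩ := lowFreq_bounds (M := M) (a := a) (ω := ω) (m := m) (Λ := Λ) (R := R)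
      hPV hσ0.le hε0.le hε'0.le x
    obtain ⟨⟨c1, c2, -, -⟩, -, -, -⟩ := lowFreq_cutoffs (M := M) (a := a) (ω := ω) (m := m) (Λ := Λ)
      (R := R) hPV x
    refine ⟨⟨h1, h2.trans hσ2⟩, h3.trans ?_, c1, c2⟩
    show σ * max (lowFreqTop ε u₀ U₁) (lowFreqTop ε' u₀' U₁') ≤ 1
    rw [max_eq_left htop, hnorm]
  · have hx' : P.x₀ + max (2 * P.T * Real.exp (1 / P.p)) Ts ≤ x := by
      show x₀ + max (2 * T * Real.exp (1 / p)) Ts ≤ x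
      rw [← hTedef]; rw [hX] at hx; exact hx
    obtain ⟨e1, e2, e3, e4⟩ := lowFreq_far_end hPV hTsT hsat hx'
    exact ⟨by rw [e1]; exact hnorm, e2, e3, e4⟩
  · intro u u₁ u₂ H Atop Abot x₁' x₂' hx hRx₁ hRx₂ hu hu₁ hode hH hS₁ hS₂ hbt hbb hAt hAb
    have hx₁' : P.xN ≤ x₁' := by
      rw [hPxN, ← (hR.strictMono hMa).le_iff_le, hxN]; linarith
    have hx₂' : x₂' ≤ P.xb := by
      rw [hPxb, ← (hR.strictMono hMa).le_iff_le, hxb]; linarith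
    have hbb' : Tendsto (fun x ↦ u₁ x + Complex.I * ϖ * u x) atBot (𝓝 0) := hbb
    have hest := lowFreq_estimate_of_params (P := P) (ϖ := ϖ) hMa hR hadm hPV hPC hD₁ hD₂ hσ0 hnorm
      htop hTsT hsat hTs'T hsat' hv0 (by linarith) hx hx₁' hx₂' hVmid hE hcut hu hu₁ hode hH hS₁
      hS₂ hbt hbb' hAt hAb
    have hbσ : b ≤ P.σ * min 1 (v / 2) / 2 := by
      show b ≤ σ * min 1 (v / 2) / 2
      rw [hbdef]
      have hmin : 0 ≤ min 1 (v / 2) := le_min zero_le_one (by linarith)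
      calc min 1 (v / 2) / (2 * BF) = (1 / BF) * min 1 (v / 2) / 2 := by field_simp
        _ ≤ σ * min 1 (v / 2) / 2 := by
            apply div_le_div_of_nonneg_right _ (by norm_num)
            exact mul_le_mul_of_nonneg_right hσBF hmin
    have hI0 : 0 ≤ ∫ x in x₁'..x₂', (‖u₁ x‖ ^ 2 + ‖u x‖ ^ 2) :=
      intervalIntegral.integral_nonneg hx fun x _ ↦ by positivity
    rw [← hb]
    exact le_trans (mul_le_mul_of_nonneg_right hbσ hI0) hest


/-- **Proposition 8.7.1 in the `𝓖_♭` form**: the same statement for the triples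
`(ω, m, Λ) ∈ 𝓖_♭(ω_high, ε_width)` (`KerrFrequencyRanges.IsFreqFlat`), with `Λ₁ = ε_width⁻¹ω_high²`
in all constants ("`ω_low > 0`, `ã₀ > 0` sufficiently small depending on `ω_high` and `ε_width`").
[cite: DafermosRodnianskiShlapentokhrothman2014, Prop. 8.7.1] -/
theorem lowFreq_estimate_of_isFreqFlat (hM : 0 < M) (hR : IsTortoiseRadius M a R)
    {ωh ε δ₀ E D₁ D₂ : ℝ} (Rb : ℝ) (hε : 0 < ε) (hδ₀ : 0 < δ₀) (hE : 2 ≤ E)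
    (hD₁ : ∀ s, |sharpBump₁ s| ≤ D₁) (hD₂ : ∀ s, |sharpBump₂ s| ≤ D₂)
    (hA : LowFreq.SmallA M a (ε⁻¹ * ωh ^ 2) δ₀ Rb E D₁ D₂) :
    ∃ X : ℝ, ∀ (ω : ℝ) (m : ℤ) (Λ : ℝ), IsFreqFlat a ωh ε ω m Λ →
      |ω| ≤ LowFreq.ω₀ M (ε⁻¹ * ωh ^ 2) δ₀ Rb D₁ D₂ →
      ∃ P : LowFreqParams, 0 < P.σ ∧ (lowFreqMultipliers M a ω m Λ R P).HasDerivs ∧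
        (∀ x, (0 ≤ (lowFreqMultipliers M a ω m Λ R P).h x ∧ (lowFreqMultipliers M a ω m Λ R P).h x ≤ 2) ∧
          |(lowFreqMultipliers M a ω m Λ R P).y x| ≤ 1 ∧
          (lowFreqMultipliers M a ω m Λ R P).χ₂ x ∈ Icc (0 : ℝ) 1 ∧
          (lowFreqMultipliers M a ω m Λ R P).χ₁ x = 1 - (lowFreqMultipliers M a ω m Λ R P).χ₂ x) ∧
        (∀ x, X ≤ x → (lowFreqMultipliers M a ω m Λ R P).y x = 1 ∧
          (lowFreqMultipliers M a ω m Λ R P).h x = 0 ∧ (lowFreqMultipliers M a ω m Λ R P).χ₂ x = 1 ∧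
          (lowFreqMultipliers M a ω m Λ R P).χ₁ x = 0) ∧
        ∀ (u u₁ u₂ H : ℝ → ℂ) (Atop Abot x₁ x₂ : ℝ), x₁ ≤ x₂ → rPlus M a + δ₀ ≤ R x₁ → R x₂ ≤ Rb →
          (∀ x, HasDerivAt u (u₁ x) x) → (∀ x, HasDerivAt u₁ (u₂ x) x) →
          (∀ x, u₂ x + ((ω ^ 2 - sepPotential M a ω m Λ (R x) : ℝ) : ℂ) * u x = H x) →
          Continuous H → Integrable (fun x ↦ ⟪H x, u₁ x⟫_ℝ) →
          Integrable (fun x ↦ (H x * conj (u x)).im) →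
          Tendsto (fun x ↦ u₁ x - Complex.I * ω * u x) atTop (𝓝 0) →
          Tendsto (fun x ↦ u₁ x +
            Complex.I * ((ω - horizonAngularVelocity M a * m : ℝ) : ℂ) * u x) atBot (𝓝 0) →
          Tendsto (fun x ↦ ‖u x‖ ^ 2) atTop (𝓝 Atop) → Tendsto (fun x ↦ ‖u x‖ ^ 2) atBot (𝓝 Abot) →
          LowFreq.b M (ε⁻¹ * ωh ^ 2) δ₀ Rb D₁ D₂ * ∫ x in x₁..x₂, (‖u₁ x‖ ^ 2 + ‖u x‖ ^ 2) ≤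
            ∫ x, combinedSource ω (ω - horizonAngularVelocity M a * m) E
              (lowFreqMultipliers M a ω m Λ R P) u u₁ H x := by
  have hΛ₁ : 0 ≤ ε⁻¹ * ωh ^ 2 := by positivity
  obtain ⟨-, -, X, H⟩ := lowFreq_estimate hM hR Rb hΛ₁ hδ₀ hE hD₁ hD₂ hA
  exact ⟨X, fun ω m Λ hF hω ↦ H ω m Λ hF.1 hF.2.2.le hω⟩

end Choice

end Kerr

end Literature.Geometry.Lorentzian
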